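import Literature.NumberTheory.Transcendental.BrownawellOneLevelCriterion
import Literature.NumberTheory.Transcendental.BrownawellCleanLevelZeroFree
import Literature.NumberTheory.Transcendental.BrownawellRedundantAuxiliary
import Literature.NumberTheory.Transcendental.BrownawellIntermittent
import Literature.NumberTheory.Transcendental.DiazAsymptotics
import Literature.NumberTheory.Transcendental.PhilipponCriterionMain
import HarnessLib

/-!
# Brownawell's intermittent theorem (LNM 1290, Thm 6.2, exponential case) from LNM 1752 Ch. 3 Prop. 4.11 — proofs only

`Literature/NumberTheory/Transcendental/BrownawellIntermittentProofs.lean`. Fourth and last file of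
the proof of the named fact `Literature.NumberTheory.Transcendental.Brownawell1987_thm_6_2_exp`
(`BrownawellIntermittent.lean`): it assembles the one-level criterion
(`BrownawellOneLevelCriterion.lean`), the redundant-variables auxiliary function
(`BrownawellRedundantAuxiliary.lean`) and the zero-free ball at a clean level
(`BrownawellCleanLevelZeroFree.lean`) along M. Waldschmidt's scheme (LNM 1752, Ch. 14, §3.3,
Steps 0–4, PDF pp. 255–257) run at ONE level `N` where Brownawell's hypothesis (4.1) holds, with
`k` redundant variables chosen so large that the reachable exponent exceeds `⌈mn/(m+n)⌉ − 1`.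

Everything here is PROVED; no named fact is introduced. The only hypothesis of the main theorem
`Brownawell1987_thm_6_2_exp_of_prop_4_11` is the tree's named fact
`Nesterenko.NesterenkoPhilippon2001_ch3_prop_4_11` (LNM 1752 Ch. 3 Prop. 4.11), the one open leaf of
the criterion; the discharge `Brownawell1987_thm_6_2_exp_holds` is the one-liner
`Brownawell1987_thm_6_2_exp_of_prop_4_11 ‹prop_4_11_holds›` once that fact lands.

## References

* [Brownawell1987] W. D. Brownawell, LNM 1290 (1987), Thm 6.2 (PDF p. 127), §IV.A (4.1) (PDF p. 124),
  §V (PDF pp. 126–127).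
* [NesterenkoPhilippon2001] LNM 1752 (2001), Ch. 14 (M. Waldschmidt) §3.3 (PDF pp. 255–257); Ch. 3
  Prop. 4.11.
-/

noncomputable section

open MvPolynomial Finset Complex Filter Real
open Literature.NumberTheory.Transcendental.Asymp

namespace Literature.NumberTheory.Transcendental

namespace Brownawell

/-! ### §1. The values, degrees and lengths of the `Q_r` at the point `θ = (e^{x_iy_j})` -/

section Links

variable {d l k L R : ℕ}

/-- The frequencies `b_{λ,h} = ∑_i λ_{hi} x_i` of the auxiliary exponential sum. [cite: NesterenkoPhilippon2001, Ch. 14 §3.3 Step 2] -/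
def bvec (x : Fin d → ℂ) (lam : Fin k × Fin d → Fin L) (h : Fin k) : ℂ := ∑ i, ((lam (h, i) : ℕ) : ℂ) * x i

/-- The coordinates `z_{r,h} = ∑_j r_{hj} y_j` of the evaluation point. [cite: NesterenkoPhilippon2001, Ch. 14 §3.3 Step 2] -/
def zvec (y : Fin l → ℂ) (r : Fin k × Fin l → Fin R) (h : Fin k) : ℂ := ∑ j, ((r (h, j) : ℕ) : ℂ) * y j

/-- The point `θ = (e^{x_iy_j})_{ij}` indexed by `Fin d × Fin l`. [folklore] -/
def thetaGrid (x : Fin d → ℂ) (y : Fin l → ℂ) : Fin d × Fin l → ℂ := fun q => cexp (x q.1 * y q.2)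

/-- Rearrangement `∑_{(i,j)} ∑_h a_{hi} b_{hj} = ∑_h (∑_i a_{hi})(∑_j b_{hj})`. [folklore] -/
theorem sum_prod_sum_mul_eq (a : Fin k → Fin d → ℂ) (b : Fin k → Fin l → ℂ) :
    ∑ q : Fin d × Fin l, ∑ h, a h q.1 * b h q.2 = ∑ h, (∑ i, a h i) * (∑ j, b h j) := by
  rw [Finset.sum_comm]
  refine Finset.sum_congr rfl fun h _ => ?_
  rw [Fintype.sum_prod_type, Finset.sum_mul_sum]

/-- **`Q_r(e^{x_iy_j}) = F(z_r) = ∑_λ p_λ e^{∑_h b_{λh} z_{rh}}`.**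
[cite: NesterenkoPhilippon2001, Ch. 14 §3.3 Step 3 (PDF p. 257: "Q_{Nr}(e^{x_1y_1}, …, e^{x_dy_ℓ}) = F(r_1y_1 + ⋯ + r_ℓy_ℓ)")] -/
theorem aeval_thetaGrid_Qpoly (x : Fin d → ℂ) (y : Fin l → ℂ) (p : (Fin k × Fin d → Fin L) → ℤ)
    (r : Fin k × Fin l → Fin R) :
    aeval (thetaGrid x y) (Qpoly p r) = ∑ lam, (p lam : ℂ) * cexp (∑ h, bvec x lam h * zvec y r h) := by
  classical
  unfold Qpoly
  rw [map_sum]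
  refine Finset.sum_congr rfl fun lam _ => ?_
  rw [aeval_monomial, algebraMap_int_eq, eq_intCast, Finsupp.prod_pow]
  congr 1
  simp only [thetaGrid, gridExp_apply, ← Complex.exp_nat_mul]
  rw [← Complex.exp_sum]
  congr 1
  -- `∑_{(i,j)} (∑_h λ_hi r_hj) x_i y_j = ∑_h (∑_i λ_hi x_i)(∑_j r_hj y_j)`
  have e1 : ∀ q : Fin d × Fin l, ((∑ h, (lam (h, q.1) : ℕ) * (r (h, q.2) : ℕ) : ℕ) : ℂ) * (x q.1 * y q.2) =
      ∑ h, (((lam (h, q.1) : ℕ) : ℂ) * x q.1) * (((r (h, q.2) : ℕ) : ℂ) * y q.2) := fun q => by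
    rw [Nat.cast_sum, Finset.sum_mul]
    refine Finset.sum_congr rfl fun h _ => ?_
    push_cast
    ring
  simp_rw [e1]
  exact sum_prod_sum_mul_eq (fun h i => ((lam (h, i) : ℕ) : ℂ) * x i) (fun h j => ((r (h, j) : ℕ) : ℂ) * y j)

/-- Degree of `Q_r`: `deg Q_r ≤ dℓ · k(L−1)(R−1)`. [cite: NesterenkoPhilippon2001, Ch. 14 §3.3 Step 3 ("total degree ≤ LR")] -/
theorem totalDegree_Qpoly_le (p : (Fin k × Fin d → Fin L) → ℤ) (r : Fin k × Fin l → Fin R) :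
    (Qpoly p r).totalDegree ≤ d * l * (k * ((L - 1) * (R - 1))) := by
  classical
  unfold Qpoly
  refine totalDegree_finsetSum_le fun lam _ => (totalDegree_monomial_le _ _).trans ?_
  rw [Finsupp.sum_fintype _ _ (fun _ => rfl)]
  simp only [id, gridExp_apply]
  calc ∑ q : Fin d × Fin l, ∑ h, (lam (h, q.1) : ℕ) * (r (h, q.2) : ℕ)
      ≤ ∑ _q : Fin d × Fin l, ∑ _h : Fin k, (L - 1) * (R - 1) :=
        Finset.sum_le_sum fun q _ => Finset.sum_le_sum fun h _ =>
          Nat.mul_le_mul (by have := (lam (h, q.1)).isLt; omega) (by have := (r (h, q.2)).isLt; omega)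
    _ = d * l * (k * ((L - 1) * (R - 1))) := by
        simp [Finset.sum_const, Finset.card_univ, Fintype.card_prod, Fintype.card_fin, mul_assoc]

/-- Length of `Q_r`: `L(Q_r) ≤ ∑_λ |p_λ|`. [cite: NesterenkoPhilippon2001, Ch. 14 §3.3 Step 3 ("usual height ≤ e^{N/2}")] -/
theorem l1_Qpoly_le (p : (Fin k × Fin d → Fin L) → ℤ) (r : Fin k × Fin l → Fin R) :
    Chudnovsky.l1 (Qpoly p r) ≤ ∑ lam, (|p lam| : ℝ) := by
  classical
  unfold Qpoly
  refine (Chudnovsky.wnorm_sum_le _ _ _).trans (Finset.sum_le_sum fun lam _ => ?_)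
  rw [Chudnovsky.wnorm_monomial]
  simp

end Links

/-! ### §2. Elementary largeness lemmas in the base parameter `s` -/

section Elementary

/-- `log s ≤ s` for a natural number `s`. [folklore] -/
theorem log_natCast_le (s : ℕ) : Real.log s ≤ s := by
  rcases Nat.eq_zero_or_pos s with rfl | hs
  · simp
  · have h := Real.log_le_sub_one_of_pos (show (0 : ℝ) < s by exact_mod_cast hs)
    linarith

/-- `C sᵃ ≤ s^{a+1}` for `s ≥ C`. [folklore] -/
theorem mul_pow_le_pow_succ {C : ℝ} {s : ℕ} {a : ℕ} (hs : C ≤ s) :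
    C * (s : ℝ) ^ a ≤ (s : ℝ) ^ (a + 1) := by
  rw [pow_succ, mul_comm]
  exact mul_le_mul_of_nonneg_left hs (by positivity)

/-- `C sᵃ ≤ s^{b}` for `s ≥ max(C, 1)` and `a < b`. [folklore] -/
theorem mul_pow_le_pow_of_lt {C : ℝ} {s : ℕ} {a b : ℕ} (hab : a < b) (hs : C ≤ s)
    (hs1 : 1 ≤ s) : C * (s : ℝ) ^ a ≤ (s : ℝ) ^ b := by
  have hs1' : (1 : ℝ) ≤ s := by exact_mod_cast hs1
  exact (mul_pow_le_pow_succ hs).trans (pow_le_pow_right₀ hs1' hab)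

/-- `C sᵃ log s ≤ s^{b}` for `s ≥ max(C, 1)` and `a + 1 < b`. [folklore] -/
theorem mul_pow_mul_log_le_pow_of_lt {C : ℝ} {s : ℕ} {a b : ℕ} (hab : a + 1 < b) (hC : 0 ≤ C)
    (hs : C ≤ s) (hs1 : 1 ≤ s) : C * (s : ℝ) ^ a * Real.log s ≤ (s : ℝ) ^ b := by
  have hs0 : (0 : ℝ) ≤ s := Nat.cast_nonneg _
  have hlog0 : 0 ≤ Real.log s := Real.log_nonneg (by exact_mod_cast hs1)
  calc C * (s : ℝ) ^ a * Real.log s ≤ C * (s : ℝ) ^ a * s :=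
        mul_le_mul_of_nonneg_left (log_natCast_le s) (by positivity)
    _ = C * (s : ℝ) ^ (a + 1) := by ring
    _ ≤ (s : ℝ) ^ b := mul_pow_le_pow_of_lt hab hs hs1

end Elementary

/-! ### §3. The numerology of the exponents -/

section Numerology

variable {d l : ℕ}

/-- With `κ₀ = [(dℓ−1)/(d+ℓ)]`: `(d+ℓ) κ₀ + 1 ≤ dℓ`, and `κ₀ ≥ 1` when `d + ℓ < dℓ`. [folklore] -/
theorem kappa_facts (hdl : d + l < d * l) :
    (d + l) * ((d * l - 1) / (d + l)) + 1 ≤ d * l ∧ 1 ≤ (d * l - 1) / (d + l) := by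
  have hpos : 0 < d + l := by
    rcases Nat.eq_zero_or_pos (d + l) with h | h
    · have hd : d = 0 := by omega
      subst hd; simp at hdl
    · exact h
  constructor
  · have h1 : (d + l) * ((d * l - 1) / (d + l)) ≤ d * l - 1 := Nat.mul_div_le _ _
    omega
  · exact (Nat.le_div_iff_mul_le hpos).mpr (by omega)

/-- The margin of the unknowns over the conditions: with `a = 2(d+ℓ)κ₀ + 1` and `kk = a + 3`,
`a (kk + 1) + 3 ≤ 2 ℓ kk d`. [folklore] -/
theorem count_margin (hdl : d + l < d * l) :
    (2 * (d + l) * ((d * l - 1) / (d + l)) + 1) * ((2 * (d + l) * ((d * l - 1) / (d + l)) + 1 + 3) + 1) + 3 ≤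
      2 * l * (2 * (d + l) * ((d * l - 1) / (d + l)) + 1 + 3) * d := by
  obtain ⟨h1, -⟩ := kappa_facts hdl
  set κ := (d * l - 1) / (d + l) with hκ
  set a := 2 * (d + l) * κ + 1 with ha
  -- `2ℓd ≥ a + 1`, hence `2ℓ kk d − a (kk+1) = kk (2ℓd − a) − a ≥ kk − a = 3`
  have h2 : a + 1 ≤ 2 * l * d := by
    have e3 : a + 1 = 2 * ((d + l) * κ + 1) := by rw [ha]; ring
    have e4 : 2 * l * d = 2 * (d * l) := by ring
    rw [e3, e4]; exact Nat.mul_le_mul_left 2 h1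
  have e2 : 2 * l * (a + 3) * d = (a + 3) * (2 * l * d) := by ring
  rw [e2]
  have h3 : (a + 3) * (a + 1) ≤ (a + 3) * (2 * l * d) := Nat.mul_le_mul_left _ h2
  nlinarith

end Numerology

/-! ### §4. Generic helpers: Dirichlet's count, the base parameter from the level, norm bounds -/

section Helpers

/-- **From a logarithmic bound to Dirichlet's count**: if `X ≥ 1`, `#Λ ≥ 1` and
`2 #ι (2 + log X) ≤ #Λ log 2` then `((2⌈X⌉ + 2)²)^{#ι} < 2^{#Λ}`. [folklore] -/
theorem count_of_log_bound {nΛ nι : ℕ} (hnΛ : 1 ≤ nΛ) {X : ℝ} (hX : 1 ≤ X)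
    (h : 2 * (nι : ℝ) * (2 + Real.log X) ≤ nΛ * Real.log 2) :
    ((2 * ⌈X⌉₊ + 2) ^ 2) ^ nι < 2 ^ nΛ := by
  set Y : ℕ := 2 * ⌈X⌉₊ + 2 with hY
  have hX0 : 0 < X := by linarith
  have hYpos : (0 : ℝ) < Y := by rw [hY]; positivity
  have hYle : (Y : ℝ) ≤ 6 * X := by
    rw [hY]; push_cast
    have := (Nat.ceil_lt_add_one hX0.le).le
    linarith
  have hlogY : Real.log Y < 2 + Real.log X := by
    have h6 : Real.log 6 < 2 := by
      rw [Real.log_lt_iff_lt_exp (by norm_num)]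
      have he := Real.exp_one_gt_d9
      have : Real.exp 2 = Real.exp 1 * Real.exp 1 := by rw [← Real.exp_add]; norm_num
      nlinarith
    calc Real.log Y ≤ Real.log (6 * X) := Real.log_le_log hYpos hYle
      _ = Real.log 6 + Real.log X := Real.log_mul (by norm_num) hX0.ne'
      _ < 2 + Real.log X := by linarith
  -- real form `Y^{2 #ι} < 2^{#Λ}`
  have hreal : ((Y : ℝ) ^ 2) ^ nι < (2 : ℝ) ^ nΛ := by
    rw [← pow_mul, ← Real.rpow_natCast, ← Real.rpow_natCast,
      Real.rpow_def_of_pos hYpos, Real.rpow_def_of_pos (by norm_num), Real.exp_lt_exp]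
    push_cast
    rcases Nat.eq_zero_or_pos nι with h0 | hpos
    · subst h0
      simp only [CharP.cast_eq_zero, mul_zero]
      have : (1 : ℝ) ≤ nΛ := by exact_mod_cast hnΛ
      have := Real.log_pos (show (1 : ℝ) < 2 by norm_num)
      positivity
    · have hι : (0 : ℝ) < nι := by exact_mod_cast hpos
      calc Real.log Y * (2 * (nι : ℝ)) < (2 + Real.log X) * (2 * nι) :=
            mul_lt_mul_of_pos_right hlogY (by positivity)
        _ = 2 * nι * (2 + Real.log X) := by ring
        _ ≤ nΛ * Real.log 2 := h
        _ = Real.log 2 * nΛ := mul_comm _ _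
  exact_mod_cast hreal

/-- **The base parameter from the level**: with `s = ⌊(N/C)^{1/q}⌋` (`C > 0`, `q ≥ 1`) one has
`C sᵠ ≤ N < C (s+1)ᵠ`, and `s ≥ s₀` as soon as `N ≥ C s₀ᵠ`. [folklore] -/
theorem base_param_facts {C : ℝ} (hC : 0 < C) {q : ℕ} (hq : 1 ≤ q) (N s₀ : ℕ)
    (hN : C * (s₀ : ℝ) ^ q ≤ N) :
    s₀ ≤ ⌊((N : ℝ) / C) ^ ((1 : ℝ) / q)⌋₊ ∧
      C * (⌊((N : ℝ) / C) ^ ((1 : ℝ) / q)⌋₊ : ℝ) ^ q ≤ N ∧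
      (N : ℝ) < C * ((⌊((N : ℝ) / C) ^ ((1 : ℝ) / q)⌋₊ : ℝ) + 1) ^ q := by
  set w : ℝ := ((N : ℝ) / C) ^ ((1 : ℝ) / q) with hw
  have hNC : 0 ≤ (N : ℝ) / C := div_nonneg (Nat.cast_nonneg _) hC.le
  have hw0 : 0 ≤ w := Real.rpow_nonneg hNC _
  have hq0 : (q : ℝ) ≠ 0 := by exact_mod_cast (show q ≠ 0 by omega)
  have hwq : w ^ q = (N : ℝ) / C := by
    rw [hw, ← Real.rpow_natCast, ← Real.rpow_mul hNC, one_div_mul_cancel hq0, Real.rpow_one]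
  have hfloor : (⌊w⌋₊ : ℝ) ≤ w := Nat.floor_le hw0
  have hlt : w < (⌊w⌋₊ : ℝ) + 1 := Nat.lt_floor_add_one w
  refine ⟨?_, ?_, ?_⟩
  · refine Nat.le_floor ?_
    -- `s₀ ≤ w` since `s₀^q ≤ w^q`
    have h1 : (s₀ : ℝ) ^ q ≤ w ^ q := by
      rw [hwq, le_div_iff₀ hC, mul_comm]; exact hN
    exact le_of_pow_le_pow_left₀ (by omega) hw0 h1
  · have h1 : (⌊w⌋₊ : ℝ) ^ q ≤ w ^ q := pow_le_pow_left₀ (Nat.cast_nonneg _) hfloor q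
    rw [hwq, le_div_iff₀ hC, mul_comm] at h1
    exact h1
  · have h1 : w ^ q < ((⌊w⌋₊ : ℝ) + 1) ^ q := pow_lt_pow_left₀ hlt hw0 (by omega)
    rw [hwq, div_lt_iff₀ hC, mul_comm] at h1
    exact h1

variable {d l k L R : ℕ}

/-- `|b_{λ,h}| ≤ L ∑_i |x_i|`. [folklore] -/
theorem norm_bvec_le (x : Fin d → ℂ) (lam : Fin k × Fin d → Fin L) (h : Fin k) :
    ‖bvec x lam h‖ ≤ (L : ℝ) * ∑ i, ‖x i‖ := by
  unfold bvec
  calc ‖∑ i, ((lam (h, i) : ℕ) : ℂ) * x i‖ ≤ ∑ i, ‖((lam (h, i) : ℕ) : ℂ) * x i‖ := norm_sum_le _ _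
    _ ≤ ∑ i, (L : ℝ) * ‖x i‖ := Finset.sum_le_sum fun i _ => by
        rw [norm_mul, Complex.norm_natCast]
        exact mul_le_mul_of_nonneg_right (by exact_mod_cast (lam (h, i)).isLt.le) (norm_nonneg _)
    _ = (L : ℝ) * ∑ i, ‖x i‖ := by rw [Finset.mul_sum]

/-- `|z_{r,h}| ≤ R ∑_j |y_j|`. [folklore] -/
theorem norm_zvec_le (y : Fin l → ℂ) (r : Fin k × Fin l → Fin R) (h : Fin k) :
    ‖zvec y r h‖ ≤ (R : ℝ) * ∑ j, ‖y j‖ := by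
  unfold zvec
  calc ‖∑ j, ((r (h, j) : ℕ) : ℂ) * y j‖ ≤ ∑ j, ‖((r (h, j) : ℕ) : ℂ) * y j‖ := norm_sum_le _ _
    _ ≤ ∑ j, (R : ℝ) * ‖y j‖ := Finset.sum_le_sum fun j _ => by
        rw [norm_mul, Complex.norm_natCast]
        exact mul_le_mul_of_nonneg_right (by exact_mod_cast (r (h, j)).isLt.le) (norm_nonneg _)
    _ = (R : ℝ) * ∑ j, ‖y j‖ := by rw [Finset.mul_sum]

/-- Products of powers of the frequencies: `|∏_h b_{λh}^{κ_h}| ≤ B^{kT}` for `|b| ≤ B`, `B ≥ 1`,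
`κ_h < T`. [folklore] -/
theorem norm_prod_pow_le {b : Fin k → ℂ} {B : ℝ} (hB1 : 1 ≤ B) (hb : ∀ h, ‖b h‖ ≤ B) {T : ℕ}
    (κ : Fin k → Fin T) : ‖∏ h, b h ^ (κ h : ℕ)‖ ≤ B ^ (k * T) := by
  rw [norm_prod]
  calc ∏ h, ‖b h ^ (κ h : ℕ)‖ ≤ ∏ _h : Fin k, B ^ T := Finset.prod_le_prod (fun h _ => norm_nonneg _) fun h _ => by
        rw [norm_pow]
        exact (pow_le_pow_left₀ (norm_nonneg _) (hb h) _).trans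
          (pow_le_pow_right₀ hB1 (κ h).isLt.le)
    _ = B ^ (k * T) := by rw [Finset.prod_const, Finset.card_univ, Fintype.card_fin, ← pow_mul, mul_comm]

/-- **Smallness of all `Q_r(θ)` from Dirichlet's output** (Step 2 of LNM 1752 Ch. 14 §3.3 at the
points `z_r`): if `|p_λ| ≤ 1`, `|b_{λh}| ≤ B` (`B ≥ 1`), `|z_{rh}| ≤ Z`, `T ≥ e² kBZ`,
`T ≥ U + kBZ + log(2 #Λ)` and all `|C_κ| ≤ e^{−(U + kZ)}/2` (`max κ_h < T`), then `|Q_r(θ)| ≤ e^{−U}`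
for every `r`. [cite: NesterenkoPhilippon2001, Ch. 14 §3.3 Step 2 (PDF p. 256)] -/
theorem norm_aeval_Qpoly_le_of_dirichlet (x : Fin d → ℂ) (y : Fin l → ℂ)
    (p : (Fin k × Fin d → Fin L) → ℤ) (hp1 : ∀ μ, |p μ| ≤ 1) (hL : 1 ≤ L) {B Z U : ℝ} (hB1 : 1 ≤ B)
    (hb : ∀ (μ : Fin k × Fin d → Fin L) (h : Fin k), ‖bvec x μ h‖ ≤ B)
    (hz : ∀ (r : Fin k × Fin l → Fin R) (h : Fin k), ‖zvec y r h‖ ≤ Z)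
    {T : ℕ} (hT1 : 1 ≤ T) (hT : Real.exp 2 * (k * B * Z) ≤ T)
    (hTU : U + k * B * Z + Real.log (2 * Fintype.card (Fin k × Fin d → Fin L)) ≤ T)
    (hC : ∀ κ : Fin k → ℕ, (∀ h, κ h < T) →
      ‖∑ μ, (p μ : ℂ) * ∏ h, bvec x μ h ^ κ h‖ ≤ Real.exp (-(U + k * Z)) / 2)
    (r : Fin k × Fin l → Fin R) :
    ‖aeval (thetaGrid x y) (Qpoly p r)‖ ≤ Real.exp (-U) := by
  rw [aeval_thetaGrid_Qpoly]
  have hB0 : 0 ≤ B := zero_le_one.trans hB1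
  have hε0 : 0 ≤ Real.exp (-(U + k * Z)) / 2 := by positivity
  have hH : ∀ μ, (|p μ| : ℝ) ≤ 1 := fun μ => by exact_mod_cast hp1 μ
  have key := norm_sum_mul_cexp_le p (bvec x) (zvec y r) hH hb (hz r) hB0 hε0 hT1 hT hC
  refine key.trans ?_
  -- `e^{−(U+kZ)}/2 · e^{kZ} = e^{−U}/2` and `#Λ · 1 · e^{kBZ − T} ≤ e^{−U}/2`
  have e1 : Real.exp (-(U + k * Z)) / 2 * Real.exp (k * Z) = Real.exp (-U) / 2 := by
    rw [div_mul_eq_mul_div, ← Real.exp_add]; ring_nf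
  haveI : Nonempty (Fin k × Fin d → Fin L) := ⟨fun _ => ⟨0, hL⟩⟩
  have hcard : (0 : ℝ) < Fintype.card (Fin k × Fin d → Fin L) := by
    exact_mod_cast Fintype.card_pos
  have e2 : (Fintype.card (Fin k × Fin d → Fin L) : ℝ) * 1 * Real.exp (k * B * Z - T) ≤
      Real.exp (-U) / 2 := by
    rw [mul_one]
    have h1 : k * B * Z - T ≤ -U - Real.log (2 * Fintype.card (Fin k × Fin d → Fin L)) := by linarith
    calc (Fintype.card (Fin k × Fin d → Fin L) : ℝ) * Real.exp (k * B * Z - T)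
        ≤ Fintype.card (Fin k × Fin d → Fin L) *
            Real.exp (-U - Real.log (2 * Fintype.card (Fin k × Fin d → Fin L))) :=
          mul_le_mul_of_nonneg_left (Real.exp_le_exp.mpr h1) hcard.le
      _ = Real.exp (-U) / 2 := by
          rw [Real.exp_sub, Real.exp_log (by positivity)]
          field_simp
  linarith

/-- **Dirichlet's box principle for the coefficients `p_λ ∈ {0, ±1}`** (Step 1 of LNM 1752 Ch. 14
§3.3 with `kk` redundant variables): under the logarithmic count condition
`2 T^k (2 + log X) ≤ L^{kd} log 2` (`X = L^{kd} B^{kT} / η`) there are integers `p_λ`, not all zero,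
`|p_λ| ≤ 1`, with `|∑_λ p_λ b_λ^κ| ≤ 2η` for all `κ ∈ ℕ^k`, `max κ_h < T`.
[cite: NesterenkoPhilippon2001, Ch. 14 §3.3 Step 1 and Ch. 16 Lemma 1.4] -/
theorem exists_p_small (x : Fin d → ℂ) {T : ℕ} (hL : 1 ≤ L) {B : ℝ} (hB1 : 1 ≤ B)
    (hb : ∀ (μ : Fin k × Fin d → Fin L) (h : Fin k), ‖bvec x μ h‖ ≤ B) {η : ℝ} (hη : 0 < η)
    (hη1 : η ≤ 1)
    (hcount : 2 * ((T ^ k : ℕ) : ℝ) * (2 + Real.log ((L : ℝ) ^ (k * d) * B ^ (k * T) / η)) ≤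
      ((L ^ (k * d) : ℕ) : ℝ) * Real.log 2) :
    ∃ p : (Fin k × Fin d → Fin L) → ℤ, p ≠ 0 ∧ (∀ μ, |p μ| ≤ 1) ∧
      ∀ κ : Fin k → ℕ, (∀ h, κ h < T) →
        ‖∑ μ, (p μ : ℂ) * ∏ h, bvec x μ h ^ κ h‖ ≤ 2 * η := by
  classical
  have hcardΛ : Fintype.card (Fin k × Fin d → Fin L) = L ^ (k * d) := by
    simp [Fintype.card_prod, Fintype.card_fin]
  have hcardι : Fintype.card (Fin k → Fin T) = T ^ k := by simp
  have hA : ∀ (ν : Fin k → Fin T) (μ : Fin k × Fin d → Fin L),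
      ‖∏ h, bvec x μ h ^ (ν h : ℕ)‖ ≤ B ^ (k * T) := fun ν μ => norm_prod_pow_le hB1 (hb μ) ν
  have hX1 : 1 ≤ (L : ℝ) ^ (k * d) * B ^ (k * T) / η := by
    rw [le_div_iff₀ hη, one_mul]
    have h1 : (1 : ℝ) ≤ (L : ℝ) ^ (k * d) := one_le_pow₀ (by exact_mod_cast hL)
    have h2 : (1 : ℝ) ≤ B ^ (k * T) := one_le_pow₀ hB1
    have := one_le_mul_of_one_le_of_one_le h1 h2
    linarith
  have hlt := count_of_log_bound (nΛ := L ^ (k * d)) (nι := T ^ k) (Nat.one_le_pow _ _ hL) hX1 hcount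
  obtain ⟨p, hp0, hp1, hsmall⟩ := exists_small_linear_forms
    (fun (ν : Fin k → Fin T) (μ : Fin k × Fin d → Fin L) => ∏ h, bvec x μ h ^ (ν h : ℕ)) hA hη 1 (by
      rw [hcardι, hcardΛ]
      have e : ((L ^ (k * d) : ℕ) : ℝ) * ((1 : ℕ) : ℝ) * B ^ (k * T) / η =
          (L : ℝ) ^ (k * d) * B ^ (k * T) / η := by push_cast; ring
      rw [e, one_add_one_eq_two]; exact hlt)
  refine ⟨p, hp0, hp1, fun κ hκ => ?_⟩
  exact hsmall (fun h => ⟨κ h, hκ h⟩)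

/-- **The count condition at the base parameter `s`**: with `L = s^{2ℓ}`,
`T = sᵃ + T₁ s^{2(ℓ+d)} + 2ℓkd·s + 1`, `B = s^{2ℓ}(X₁+1)`, `η = e^{−(sᵃ + k C_R s^{2d}(Y₁+1))}/4`,
the margin `a(k+1)+3 ≤ 2ℓkd` and `s log 2 ≥ 2 C_T^k C_x`, one has `2 T^k (2 + log X) ≤ L^{kd} log 2`.
[cite: NesterenkoPhilippon2001, Ch. 14 §3.3 Step 1 and Exercise (PDF p. 257: "n > uv + u + t")] -/
theorem count_bound_at {d l kk a T1 CR s L T : ℕ} {X1 Y1 CT Cx Bb η : ℝ} (hX1 : 0 ≤ X1)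
    (hY1 : 0 ≤ Y1) (hCT : CT = 2 + T1 + 2 * l * kk * d)
    (hCx : Cx = 6 + 2 * l * kk * d + kk * CT * (2 * l + X1 + 1) + kk * CR * (Y1 + 1))
    (hL : L = s ^ (2 * l)) (hT : T = s ^ a + T1 * s ^ (2 * (l + d)) + 2 * l * kk * d * s + 1)
    (hBb : Bb = (s : ℝ) ^ (2 * l) * (X1 + 1))
    (hη : η = Real.exp (-((s : ℝ) ^ a + kk * ((CR : ℝ) * (s : ℝ) ^ (2 * d) * (Y1 + 1)))) / 4)
    (ha : 2 * (l + d) ≤ a) (ha1 : 1 ≤ a) (hmargin : a * (kk + 1) + 3 ≤ 2 * l * kk * d)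
    (hs1 : 1 ≤ s) (hsB : 2 * CT ^ kk * Cx ≤ s * Real.log 2) :
    2 * ((T ^ kk : ℕ) : ℝ) * (2 + Real.log ((L : ℝ) ^ (kk * d) * Bb ^ (kk * T) / η)) ≤
      ((L ^ (kk * d) : ℕ) : ℝ) * Real.log 2 := by
  have hsR : (1 : ℝ) ≤ s := by exact_mod_cast hs1
  have hsR0 : (0 : ℝ) < s := by linarith
  have hlogs : Real.log s ≤ s := log_natCast_le s
  have hl0 : (0 : ℝ) ≤ l := Nat.cast_nonneg _
  have hkk0 : (0 : ℝ) ≤ kk := Nat.cast_nonneg _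
  have hd0 : (0 : ℝ) ≤ d := Nat.cast_nonneg _
  have hT10 : (0 : ℝ) ≤ T1 := Nat.cast_nonneg _
  have hCR0 : (0 : ℝ) ≤ CR := Nat.cast_nonneg _
  have hCT0 : 0 ≤ CT := by rw [hCT]; positivity
  -- the quantity `W = sᵃ + k C_R s^{2d} (Y₁+1)` in the exponent of `η`
  obtain ⟨W, hW⟩ : ∃ W : ℝ, W = (s : ℝ) ^ a + kk * ((CR : ℝ) * (s : ℝ) ^ (2 * d) * (Y1 + 1)) :=
    ⟨_, rfl⟩
  have hW0 : 0 ≤ W := by rw [hW]; positivity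
  rw [← hW] at hη
  have hLR : (L : ℝ) = (s : ℝ) ^ (2 * l) := by rw [hL, Nat.cast_pow]
  have hLpos : (0 : ℝ) < L := by rw [hLR]; positivity
  have hBbpos : 0 < Bb := by rw [hBb]; positivity
  have hηpos : 0 < η := by rw [hη]; positivity
  -- logarithms of the three factors
  have hlogL : Real.log L ≤ 2 * l * s := by
    rw [hLR, Real.log_pow]; push_cast
    have := mul_le_mul_of_nonneg_left hlogs (show (0 : ℝ) ≤ 2 * l by positivity)
    linarith
  have hlogBb : Real.log Bb ≤ 2 * l * s + X1 := by
    rw [hBb, Real.log_mul (by positivity) (by linarith), Real.log_pow]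
    have h1 : Real.log (X1 + 1) ≤ X1 := (Real.log_le_sub_one_of_pos (by linarith)).trans (by linarith)
    have := mul_le_mul_of_nonneg_left hlogs (show (0 : ℝ) ≤ 2 * l by positivity)
    push_cast; linarith
  have hlogη : -Real.log η ≤ W + 3 := by
    rw [hη, Real.log_div (Real.exp_pos _).ne' (by norm_num), Real.log_exp]
    have : Real.log 4 ≤ 3 := (Real.log_le_sub_one_of_pos (by norm_num)).trans (by norm_num)
    linarith
  have hlogX : Real.log ((L : ℝ) ^ (kk * d) * Bb ^ (kk * T) / η) ≤
      (kk * d) * (2 * l * s) + (kk * T) * (2 * l * s + X1) + (W + 3) := by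
    rw [Real.log_div (by positivity) hηpos.ne', Real.log_mul (by positivity) (by positivity),
      Real.log_pow, Real.log_pow]
    have h1 : ((kk * d : ℕ) : ℝ) * Real.log L ≤ (kk * d) * (2 * l * s) := by
      push_cast; exact mul_le_mul_of_nonneg_left hlogL (by positivity)
    have h2 : ((kk * T : ℕ) : ℝ) * Real.log Bb ≤ (kk * T) * (2 * l * s + X1) := by
      push_cast; exact mul_le_mul_of_nonneg_left hlogBb (by positivity)
    linarith
  -- powers of `s`
  have hpa : (s : ℝ) ^ (2 * (l + d)) ≤ (s : ℝ) ^ a := pow_le_pow_right₀ hsR ha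
  have hsa : (s : ℝ) ≤ (s : ℝ) ^ a := le_self_pow₀ hsR (by omega : a ≠ 0)
  have h1a : (1 : ℝ) ≤ (s : ℝ) ^ a := one_le_pow₀ hsR
  have h2d : (s : ℝ) ^ (2 * d) ≤ (s : ℝ) ^ a := pow_le_pow_right₀ hsR (by omega)
  have hsa1 : (s : ℝ) ^ a ≤ (s : ℝ) ^ (a + 1) := pow_le_pow_right₀ hsR (by omega)
  have hsa1' : (s : ℝ) ^ (a + 1) = (s : ℝ) ^ a * s := pow_succ _ _
  have hsa0 : (0 : ℝ) ≤ (s : ℝ) ^ a := by positivity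
  -- `T ≤ C_T sᵃ`
  have hTR : (T : ℝ) ≤ CT * (s : ℝ) ^ a := by
    rw [hT, hCT]; push_cast
    have e1 := mul_le_mul_of_nonneg_left hpa hT10
    have e2 := mul_le_mul_of_nonneg_left hsa (show (0 : ℝ) ≤ 2 * l * kk * d by positivity)
    linarith
  have hT0 : (0 : ℝ) ≤ T := Nat.cast_nonneg _
  -- `2 + log X ≤ C_x s^{a+1}`
  have hlogX' : 2 + Real.log ((L : ℝ) ^ (kk * d) * Bb ^ (kk * T) / η) ≤ Cx * (s : ℝ) ^ (a + 1) := by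
    have e1 : (kk : ℝ) * T * (2 * l * s + X1) ≤ kk * CT * (2 * l + X1) * (s : ℝ) ^ (a + 1) := by
      have f1 : 2 * l * (s : ℝ) + X1 ≤ (2 * l + X1) * s := by
        have := mul_le_mul_of_nonneg_left hsR hX1
        linarith
      calc (kk : ℝ) * T * (2 * l * s + X1) ≤ kk * (CT * (s : ℝ) ^ a) * ((2 * l + X1) * s) :=
            mul_le_mul (mul_le_mul_of_nonneg_left hTR hkk0) f1 (by positivity) (by positivity)
        _ = kk * CT * (2 * l + X1) * (s : ℝ) ^ (a + 1) := by rw [hsa1']; ring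
    have e2 : W ≤ (1 + kk * CR * (Y1 + 1)) * (s : ℝ) ^ (a + 1) := by
      rw [hW]
      have f1 : (s : ℝ) ^ (2 * d) ≤ (s : ℝ) ^ (a + 1) := h2d.trans hsa1
      have := mul_le_mul_of_nonneg_left f1 (show (0 : ℝ) ≤ kk * (CR * (Y1 + 1)) by positivity)
      linarith
    have e3 : (5 : ℝ) + kk * d * (2 * l * s) ≤ (5 + 2 * l * kk * d) * (s : ℝ) ^ (a + 1) := by
      have f1 : (s : ℝ) ≤ (s : ℝ) ^ (a + 1) := hsa.trans hsa1
      have f2 : (1 : ℝ) ≤ (s : ℝ) ^ (a + 1) := h1a.trans hsa1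
      have := mul_le_mul_of_nonneg_left f1 (show (0 : ℝ) ≤ 2 * l * kk * d by positivity)
      linarith
    have e4 : (5 + 2 * l * kk * d) + kk * CT * (2 * l + X1) + (1 + kk * CR * (Y1 + 1)) ≤ Cx := by
      rw [hCx]; have := mul_nonneg hkk0 hCT0; linarith
    have e5 := mul_le_mul_of_nonneg_right e4 (show (0 : ℝ) ≤ (s : ℝ) ^ (a + 1) by positivity)
    linarith
  -- assemble: `2 T^k (2 + log X) ≤ 2 C_T^k C_x s^{ak+a+1} ≤ log 2 · s^{ak+a+2} ≤ log 2 · L^{kd}`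
  have hlog2 : 0 < Real.log 2 := Real.log_pos (by norm_num)
  have hX2 : 0 ≤ 2 + Real.log ((L : ℝ) ^ (kk * d) * Bb ^ (kk * T) / η) := by
    have : 1 ≤ (L : ℝ) ^ (kk * d) * Bb ^ (kk * T) / η := by
      rw [le_div_iff₀ hηpos, one_mul]
      have h1 : (1 : ℝ) ≤ (L : ℝ) ^ (kk * d) := one_le_pow₀ (by rw [hLR]; exact one_le_pow₀ hsR)
      have h2 : (1 : ℝ) ≤ Bb ^ (kk * T) := by
        refine one_le_pow₀ ?_
        have hs2l : (1 : ℝ) ≤ (s : ℝ) ^ (2 * l) := one_le_pow₀ hsR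
        rw [hBb]
        calc (1 : ℝ) = 1 * 1 := by ring
          _ ≤ (s : ℝ) ^ (2 * l) * (X1 + 1) := mul_le_mul hs2l (by linarith) zero_le_one (by positivity)
      have h3 : η ≤ 1 := by
        rw [hη]
        have : Real.exp (-W) ≤ 1 := Real.exp_le_one_iff.mpr (by linarith)
        linarith
      have := one_le_mul_of_one_le_of_one_le h1 h2
      linarith
    have := Real.log_nonneg this
    linarith
  have hTk : ((T ^ kk : ℕ) : ℝ) ≤ CT ^ kk * (s : ℝ) ^ (a * kk) := by
    push_cast
    rw [pow_mul, ← mul_pow]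
    exact pow_le_pow_left₀ hT0 hTR kk
  have hLk : ((L ^ (kk * d) : ℕ) : ℝ) = (s : ℝ) ^ (2 * l * kk * d) := by
    push_cast; rw [hLR, ← pow_mul, show 2 * l * (kk * d) = 2 * l * kk * d by ring]
  rw [hLk]
  calc 2 * ((T ^ kk : ℕ) : ℝ) * (2 + Real.log ((L : ℝ) ^ (kk * d) * Bb ^ (kk * T) / η))
      ≤ 2 * (CT ^ kk * (s : ℝ) ^ (a * kk)) * (Cx * (s : ℝ) ^ (a + 1)) :=
        mul_le_mul (mul_le_mul_of_nonneg_left hTk (by norm_num)) hlogX' hX2 (by positivity)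
    _ = (2 * CT ^ kk * Cx) * (s : ℝ) ^ (a * kk + (a + 1)) := by rw [pow_add]; ring
    _ ≤ ((s : ℝ) * Real.log 2) * (s : ℝ) ^ (a * kk + (a + 1)) :=
        mul_le_mul_of_nonneg_right hsB (by positivity)
    _ = Real.log 2 * (s : ℝ) ^ (a * kk + (a + 1) + 1) := by rw [pow_succ]; ring
    _ ≤ Real.log 2 * (s : ℝ) ^ (2 * l * kk * d) :=
        mul_le_mul_of_nonneg_left (pow_le_pow_right₀ hsR (by
          have e : a * (kk + 1) = a * kk + a := by ring
          omega)) hlog2.le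
    _ = (s : ℝ) ^ (2 * l * kk * d) * Real.log 2 := mul_comm _ _

/-- **Lower bounds for `T`**: with `T = sᵃ + T₁ s^{2(ℓ+d)} + 2ℓkd·s + 1`, `T₁ = ⌈8 C_W⌉`,
`C_W = k C_R (X₁+1)(Y₁+1)`: `e² k B Z ≤ T` and `sᵃ + kBZ + log(2 #Λ) ≤ T`.
[cite: NesterenkoPhilippon2001, Ch. 14 §3.3 Step 2 ("(TU)^{1/2} > e^{N+3} ≥ rW")] -/
theorem T_lower_facts {d l kk a T1 CR s L T : ℕ} {X1 Y1 CW Bb Zb : ℝ} (hX1 : 0 ≤ X1)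
    (hY1 : 0 ≤ Y1) (hCW : CW = kk * CR * (X1 + 1) * (Y1 + 1)) (hT1 : T1 = ⌈8 * CW⌉₊)
    (hL : L = s ^ (2 * l)) (hT : T = s ^ a + T1 * s ^ (2 * (l + d)) + 2 * l * kk * d * s + 1)
    (hBb : Bb = (s : ℝ) ^ (2 * l) * (X1 + 1)) (hZb : Zb = (CR : ℝ) * (s : ℝ) ^ (2 * d) * (Y1 + 1))
    (hs1 : 1 ≤ s) :
    Real.exp 2 * (kk * Bb * Zb) ≤ T ∧
      (s : ℝ) ^ a + kk * Bb * Zb + Real.log (2 * Fintype.card (Fin kk × Fin d → Fin L)) ≤ T := by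
  classical
  have hs0 : (0 : ℝ) < s := by exact_mod_cast hs1
  have hCW0 : 0 ≤ CW := by rw [hCW]; positivity
  have hprod : (kk : ℝ) * Bb * Zb = CW * (s : ℝ) ^ (2 * (l + d)) := by
    rw [hBb, hZb, hCW, show 2 * (l + d) = 2 * l + 2 * d by ring, pow_add]; ring
  have hT1ge : 8 * CW ≤ T1 := by rw [hT1]; exact Nat.le_ceil _
  have hTR : (T : ℝ) = (s : ℝ) ^ a + T1 * (s : ℝ) ^ (2 * (l + d)) + 2 * l * kk * d * s + 1 := by
    rw [hT]; push_cast; ring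
  have hpow0 : (0 : ℝ) ≤ (s : ℝ) ^ (2 * (l + d)) := by positivity
  have hsa0 : (0 : ℝ) ≤ (s : ℝ) ^ a := by positivity
  have hlin0 : (0 : ℝ) ≤ 2 * l * kk * d * s := by positivity
  have e1 : CW * (s : ℝ) ^ (2 * (l + d)) ≤ T1 * (s : ℝ) ^ (2 * (l + d)) :=
    mul_le_mul_of_nonneg_right (by linarith) hpow0
  constructor
  · have he : Real.exp 2 ≤ 8 := by
      have h1 := Real.exp_one_lt_d9
      have h2 : Real.exp 2 = Real.exp 1 * Real.exp 1 := by rw [← Real.exp_add]; norm_num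
      nlinarith [Real.exp_pos 1]
    rw [hprod, hTR]
    have e2 : Real.exp 2 * (CW * (s : ℝ) ^ (2 * (l + d))) ≤ T1 * (s : ℝ) ^ (2 * (l + d)) := by
      rw [← mul_assoc]
      refine mul_le_mul_of_nonneg_right ?_ hpow0
      have := mul_le_mul_of_nonneg_right he hCW0
      linarith
    linarith
  · have hcard : (Fintype.card (Fin kk × Fin d → Fin L) : ℝ) = (s : ℝ) ^ (2 * l * (kk * d)) := by
      rw [Fintype.card_fun, Fintype.card_prod, Fintype.card_fin, Fintype.card_fin, Fintype.card_fin,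
        hL]
      push_cast; rw [← pow_mul]
    have hlog : Real.log (2 * Fintype.card (Fin kk × Fin d → Fin L)) ≤ 1 + 2 * l * kk * d * s := by
      rw [hcard, Real.log_mul (by norm_num) (pow_pos hs0 _).ne', Real.log_pow]
      have h2 : Real.log 2 ≤ 1 := by have := Real.log_two_lt_d9; linarith
      have h3 := mul_le_mul_of_nonneg_left (log_natCast_le s)
        (show (0 : ℝ) ≤ 2 * l * (kk * d) by positivity)
      push_cast; linarith
    rw [hprod, hTR]
    linarith

/-- **The zero-free ball at the clean level, in the parameters of the base `s`** (wrapper of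
`exists_aeval_Qpoly_ne_zero_of_clean`): with `G = (d+1)!(kd)ᵈ + 1`, `C_R = 2(d+1)G`, `L = s^{2ℓ}`,
`R = C_R s^{2d}`, `D₁ = kd s^{2ℓ}`, a clean level `N ≥ C₅ s^{4(ℓ+d)}` and
`ρ = 4N^ε + 2 log(Q_v + 1) + ρ₀`, some `Q_r` does not vanish at any `μ` with
`|e^{x_iy_j} − μ_{ij}| ≤ e^{−ρ}`. [cite: NesterenkoPhilippon2001, Ch. 14 §3.3 Step 3 and Lemma 3.7]
[cite: Brownawell1987, §V i)–iii) (PDF pp. 126–127)] -/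
theorem exists_r_ne_zero_at (hd : 2 ≤ d) (hl : 2 ≤ l) {hd1 : 1 ≤ d} (hkk : 1 ≤ k)
    {x : Fin d → ℂ} {y : Fin l → ℂ} (hx : LinearIndependent ℚ x) (hy : LinearIndependent ℚ y)
    {c : ℝ} (hc : 0 < c) (hZ : DiazThm1.ZeroLemmaAt d hd1 c)
    {G CR s : ℕ} (hG : G = (d + 1).factorial * (k * d) ^ d + 1) (hCR : CR = 2 * (d + 1) * G)
    (hL : L = s ^ (2 * l)) (hRn : R = CR * s ^ (2 * d)) (hs1 : 1 ≤ s)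
    {C5 : ℝ} (hC5 : C5 = c * DiazThm1.Delta0 x y * ((k : ℝ) * d) ^ 2 * (CR : ℝ) ^ 2)
    {N : ℕ} (hsN : C5 * (s : ℝ) ^ (4 * (l + d)) ≤ N) {ε : ℝ} (hclean : BrownawellLevel ε x y N)
    {p : (Fin k × Fin d → Fin L) → ℤ} (hp : p ≠ 0)
    {Qv : ℝ} (hQv : Qv = c * DiazThm1.Delta0 x y * ((k : ℝ) * d * (s : ℝ) ^ (2 * l)) ^ 2 *
      ((((R - 1 : ℕ) : ℝ)) / (d + 1)) ^ 2)
    {ρ0 : ℝ} (hρ0 : ρ0 = 4 * ((∑ i, ∑ j, ‖cexp (-(x i * y j))‖) + l + 1) + 2)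
    {ρ : ℝ} (hρ : ρ = 4 * (N : ℝ) ^ ε + 2 * Real.log (Qv + 1) + ρ0)
    {μ : Fin d → Fin l → ℂ} (hμ : ∀ i j, ‖cexp (x i * y j) - μ i j‖ ≤ Real.exp (-ρ)) :
    ∃ r : Fin k × Fin l → Fin R, aeval (fun q : Fin d × Fin l => μ q.1 q.2) (Qpoly p r) ≠ 0 := by
  classical
  have hsR : (1 : ℝ) ≤ s := by exact_mod_cast hs1
  have hΔ0 : 0 < DiazThm1.Delta0 x y := DiazThm1.Delta0_pos x y
  obtain ⟨Δ, hΔ⟩ : ∃ Δ : ℝ, Δ = DiazThm1.Delta0 x y := ⟨_, rfl⟩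
  rw [← hΔ] at hC5 hQv hΔ0
  obtain ⟨D₁, hD₁⟩ : ∃ D₁ : ℝ, D₁ = (k : ℝ) * d * (s : ℝ) ^ (2 * l) := ⟨_, rfl⟩
  obtain ⟨ρR, hρR⟩ : ∃ ρR : ℝ, ρR = (((R - 1 : ℕ) : ℝ)) / (d + 1) := ⟨_, rfl⟩
  rw [← hD₁, ← hρR] at hQv
  have hd1R : (0 : ℝ) < d + 1 := by positivity
  have hkd1 : 1 ≤ k * d := Nat.mul_pos (by omega) (by omega)
  have hG1 : 1 ≤ G := by rw [hG]; omega
  -- (a) `G s^{2d} ≤ ρR ≤ C_R s^{2d}`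
  have ht1 : 1 ≤ (d + 1) * (G * s ^ (2 * d)) :=
    Nat.mul_pos (Nat.succ_pos _) (Nat.mul_pos (by omega) (pow_pos (by omega) _))
  have hRn1 : (d + 1) * (G * s ^ (2 * d)) ≤ R - 1 := by
    rw [hRn, hCR]
    have e : 2 * (d + 1) * G * s ^ (2 * d) = 2 * ((d + 1) * (G * s ^ (2 * d))) := by ring
    rw [e]; omega
  have hR2 : 2 ≤ R := by omega
  have hρR_ge : (G : ℝ) * (s : ℝ) ^ (2 * d) ≤ ρR := by
    rw [hρR, le_div_iff₀ hd1R]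
    have : (((d + 1) * (G * s ^ (2 * d)) : ℕ) : ℝ) ≤ ((R - 1 : ℕ) : ℝ) := by exact_mod_cast hRn1
    push_cast at this; linarith
  have hρR_le : ρR ≤ (CR : ℝ) * (s : ℝ) ^ (2 * d) := by
    rw [hρR, div_le_iff₀ hd1R]
    have h1 : ((R - 1 : ℕ) : ℝ) ≤ R := by exact_mod_cast Nat.sub_le R 1
    have h2 : (R : ℝ) = CR * (s : ℝ) ^ (2 * d) := by rw [hRn]; push_cast; ring
    rw [h2] at h1
    exact h1.trans (le_mul_of_one_le_right (by positivity) (by linarith))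
  have hGs1 : (1 : ℝ) ≤ (G : ℝ) * (s : ℝ) ^ (2 * d) :=
    one_le_mul_of_one_le_of_one_le (by exact_mod_cast hG1) (one_le_pow₀ hsR)
  have hρR0 : 0 ≤ ρR := le_trans (by positivity) hρR_ge
  -- (b) `D₁`
  have hkdR : (1 : ℝ) ≤ (k : ℝ) * d := by exact_mod_cast hkd1
  have hD₁1 : 1 ≤ D₁ := by
    rw [hD₁]; exact one_le_mul_of_one_le_of_one_le hkdR (one_le_pow₀ hsR)
  have hD₁0 : 0 ≤ D₁ := zero_le_one.trans hD₁1
  have hD₁' : ((k * d * (L - 1) : ℕ) : ℝ) ≤ D₁ := by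
    have h1 : k * d * (L - 1) ≤ k * d * L := Nat.mul_le_mul_left _ (Nat.sub_le L 1)
    have h2 : ((k * d * (L - 1) : ℕ) : ℝ) ≤ ((k * d * L : ℕ) : ℝ) := by exact_mod_cast h1
    refine h2.trans (le_of_eq ?_)
    rw [hD₁, hL]; push_cast; ring
  -- (c) `h11a`
  have hF : ((d + 1).factorial : ℝ) * ((k : ℝ) * d) ^ d < G := by
    have : (d + 1).factorial * (k * d) ^ d < G := by rw [hG]; exact Nat.lt_succ_self _
    exact_mod_cast this
  have h11a : ((d + 1).factorial : ℝ) * 1 * D₁ ^ d < ρR ^ l := by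
    have e1 : ((d + 1).factorial : ℝ) * 1 * D₁ ^ d =
        (((d + 1).factorial : ℝ) * ((k : ℝ) * d) ^ d) * (s : ℝ) ^ (2 * l * d) := by
      rw [hD₁, mul_pow, ← pow_mul]; ring
    rw [e1]
    have hsp : (0 : ℝ) < (s : ℝ) ^ (2 * l * d) := by positivity
    calc (((d + 1).factorial : ℝ) * ((k : ℝ) * d) ^ d) * (s : ℝ) ^ (2 * l * d)
        < G * (s : ℝ) ^ (2 * l * d) := mul_lt_mul_of_pos_right hF hsp
      _ ≤ (G : ℝ) ^ l * (s : ℝ) ^ (2 * l * d) :=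
          mul_le_mul_of_nonneg_right (le_self_pow₀ (by exact_mod_cast hG1) (by omega)) hsp.le
      _ = ((G : ℝ) * (s : ℝ) ^ (2 * d)) ^ l := by
          rw [mul_pow, ← pow_mul, show 2 * d * l = 2 * l * d by ring]
      _ ≤ ρR ^ l := pow_le_pow_left₀ (by positivity) hρR_ge l
  -- (d) `h11b`
  have h11b : (d + 1 : ℝ) * D₁ < ρR ^ (l - 1) := by
    have hGbig : (d + 1) * (k * d) < G := by
      rw [hG]
      have h1 : d + 1 ≤ (d + 1).factorial := Nat.self_le_factorial _
      have h2 : k * d ≤ (k * d) ^ d := Nat.le_self_pow (by omega) _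
      have := Nat.mul_le_mul h1 h2
      omega
    have hGbigR : ((d : ℝ) + 1) * ((k : ℝ) * d) < G := by exact_mod_cast hGbig
    have e1 : (d + 1 : ℝ) * D₁ = ((d : ℝ) + 1) * ((k : ℝ) * d) * (s : ℝ) ^ (2 * l) := by
      rw [hD₁]; ring
    rw [e1]
    have hsp : (0 : ℝ) < (s : ℝ) ^ (2 * l) := by positivity
    have hexp : 2 * l ≤ 2 * d * (l - 1) := by
      have : 2 * 2 * (l - 1) ≤ 2 * d * (l - 1) := Nat.mul_le_mul_right _ (by omega)
      omega
    calc ((d : ℝ) + 1) * ((k : ℝ) * d) * (s : ℝ) ^ (2 * l)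
        < G * (s : ℝ) ^ (2 * l) := mul_lt_mul_of_pos_right hGbigR hsp
      _ ≤ G * (s : ℝ) ^ (2 * d * (l - 1)) :=
          mul_le_mul_of_nonneg_left (pow_le_pow_right₀ hsR hexp) (by positivity)
      _ ≤ (G : ℝ) ^ (l - 1) * (s : ℝ) ^ (2 * d * (l - 1)) :=
          mul_le_mul_of_nonneg_right (le_self_pow₀ (by exact_mod_cast hG1) (by omega))
            (by positivity)
      _ = ((G : ℝ) * (s : ℝ) ^ (2 * d)) ^ (l - 1) := by rw [mul_pow, ← pow_mul]
      _ ≤ ρR ^ (l - 1) := pow_le_pow_left₀ (by positivity) hρR_ge _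
  -- (e) the clean bounds are below `N`
  have hC50 : 0 ≤ C5 := by rw [hC5]; positivity
  have hC5s : ∀ {e : ℕ}, e ≤ 4 * (l + d) → C5 * (s : ℝ) ^ e ≤ N := fun he =>
    (mul_le_mul_of_nonneg_left (pow_le_pow_right₀ hsR he) hC50).trans hsN
  have hCR1 : (1 : ℝ) ≤ CR := by
    have : 1 ≤ CR := by rw [hCR]; exact Nat.mul_pos (Nat.mul_pos (by norm_num) (Nat.succ_pos _)) hG1
    exact_mod_cast this
  have hbx : c * Δ * D₁ ^ 2 * ρR ≤ N := by
    calc c * Δ * D₁ ^ 2 * ρR ≤ c * Δ * D₁ ^ 2 * ((CR : ℝ) * (s : ℝ) ^ (2 * d)) :=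
          mul_le_mul_of_nonneg_left hρR_le (by positivity)
      _ = (c * Δ * ((k : ℝ) * d) ^ 2 * CR) * (s : ℝ) ^ (4 * l + 2 * d) := by
          rw [hD₁, pow_add, mul_pow, ← pow_mul, show 2 * l * 2 = 4 * l by ring]; ring
      _ ≤ (c * Δ * ((k : ℝ) * d) ^ 2 * (CR : ℝ) ^ 2) * (s : ℝ) ^ (4 * l + 2 * d) := by
          apply mul_le_mul_of_nonneg_right _ (by positivity)
          have : (CR : ℝ) ≤ (CR : ℝ) ^ 2 := le_self_pow₀ hCR1 (by norm_num)
          exact mul_le_mul_of_nonneg_left this (by positivity)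
      _ = C5 * (s : ℝ) ^ (4 * l + 2 * d) := by rw [hC5]
      _ ≤ N := hC5s (by omega)
  have hby : c * Δ * D₁ * ρR ^ 2 ≤ N := by
    calc c * Δ * D₁ * ρR ^ 2 ≤ c * Δ * D₁ * ((CR : ℝ) * (s : ℝ) ^ (2 * d)) ^ 2 :=
          mul_le_mul_of_nonneg_left (pow_le_pow_left₀ hρR0 hρR_le 2) (by positivity)
      _ = (c * Δ * ((k : ℝ) * d) * (CR : ℝ) ^ 2) * (s : ℝ) ^ (2 * l + 4 * d) := by
          rw [hD₁, pow_add, mul_pow, ← pow_mul, show 2 * d * 2 = 4 * d by ring]; ring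
      _ ≤ (c * Δ * ((k : ℝ) * d) ^ 2 * (CR : ℝ) ^ 2) * (s : ℝ) ^ (2 * l + 4 * d) := by
          apply mul_le_mul_of_nonneg_right _ (by positivity)
          have : (k : ℝ) * d ≤ ((k : ℝ) * d) ^ 2 := le_self_pow₀ hkdR (by norm_num)
          exact mul_le_mul_of_nonneg_right (mul_le_mul_of_nonneg_left this (by positivity))
            (by positivity)
      _ = C5 * (s : ℝ) ^ (2 * l + 4 * d) := by rw [hC5]
      _ ≤ N := hC5s (by omega)
  have hcleanx : ∀ lam : Fin d → ℤ, lam ≠ 0 →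
      (∀ i, (|lam i| : ℝ) ≤ c * Δ * D₁ ^ 2 * ρR) →
      Real.exp (-((N : ℝ) ^ ε)) ≤ ‖∑ i, (lam i : ℂ) * x i‖ :=
    fun lam hlam hbd => hclean.1 lam hlam fun i => by
      have := (hbd i).trans hbx
      exact_mod_cast this
  have hcleany : ∀ nu : Fin l → ℤ, nu ≠ 0 →
      (∀ j, (|nu j| : ℝ) ≤ c * Δ * D₁ * ρR ^ 2) →
      Real.exp (-((N : ℝ) ^ ε)) ≤ ‖∑ j, (nu j : ℂ) * y j‖ :=
    fun nu hnu hbd => hclean.2 nu hnu fun j => by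
      have := (hbd j).trans hby
      exact_mod_cast this
  -- (f) `ρ`
  have hQv0 : 0 ≤ Qv := by rw [hQv]; positivity
  have hNε : 0 ≤ (N : ℝ) ^ ε := Real.rpow_nonneg (Nat.cast_nonneg _) _
  have hlogQ : 0 ≤ Real.log (Qv + 1) := Real.log_nonneg (by linarith)
  have hsum0 : 0 ≤ ∑ i, ∑ j, ‖cexp (-(x i * y j))‖ :=
    Finset.sum_nonneg fun i _ => Finset.sum_nonneg fun j _ => norm_nonneg _
  have hl0 : (0 : ℝ) ≤ l := Nat.cast_nonneg _
  have hρ00 : 0 ≤ ρ0 := by rw [hρ0]; positivity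
  have hρ' : 4 * ((∑ i, ∑ j, ‖cexp (-(x i * y j))‖) + l + 1) ≤ ρ := by
    rw [hρ, hρ0]; linarith
  have hρbig : c * Δ * D₁ ^ 2 * ρR ^ 2 * Real.exp (-(ρ / 2)) < Real.exp (-(2 * (N : ℝ) ^ ε)) := by
    rw [← hQv]
    have e : -(ρ / 2) = -(2 * (N : ℝ) ^ ε) + -Real.log (Qv + 1) + -(ρ0 / 2) := by rw [hρ]; ring
    rw [e, Real.exp_add, Real.exp_add, Real.exp_neg (Real.log (Qv + 1)), Real.exp_log (by linarith)]
    have hA := Real.exp_pos (-(2 * (N : ℝ) ^ ε))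
    have h1 : Qv * (Qv + 1)⁻¹ < 1 := by
      rw [← div_eq_mul_inv, div_lt_one (by linarith)]; linarith
    have h2 : Real.exp (-(ρ0 / 2)) ≤ 1 := Real.exp_le_one_iff.mpr (by linarith)
    have h3 : 0 ≤ Qv * (Qv + 1)⁻¹ := by positivity
    calc Qv * (Real.exp (-(2 * (N : ℝ) ^ ε)) * (Qv + 1)⁻¹ * Real.exp (-(ρ0 / 2)))
        = Real.exp (-(2 * (N : ℝ) ^ ε)) * ((Qv * (Qv + 1)⁻¹) * Real.exp (-(ρ0 / 2))) := by ring
      _ ≤ Real.exp (-(2 * (N : ℝ) ^ ε)) * ((Qv * (Qv + 1)⁻¹) * 1) := by gcongr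
      _ < Real.exp (-(2 * (N : ℝ) ^ ε)) * 1 := by
          rw [mul_one]; exact mul_lt_mul_of_pos_left h1 hA
      _ = Real.exp (-(2 * (N : ℝ) ^ ε)) := mul_one _
  subst hΔ hρR
  exact exists_aeval_Qpoly_ne_zero_of_clean hd1 hl hkk hx hy hZ hp hR2 hD₁1 hD₁' h11a h11b
    hcleanx hcleany hρ' hρbig hμ

/-- **Growth of the radius exponent**: `1 + ρ ≤ C_ρ s^{2(ℓ+d)}` where
`ρ = 4N^ε + 2 log(Q_v+1) + ρ₀`, `N < C₅ (s+1)^{4(ℓ+d)}`, `ε ≤ 1/2`, `Q_v ≤ C₅ s^{4(ℓ+d)}`.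
[cite: Brownawell1987, §V iii) (PDF p. 127: "log max{m_I, n_J} ≪ N_l^{4ε}")] -/
theorem one_add_rho_le {d l s N : ℕ} {C5 Qv ρ0 ε Cρ : ℝ} (hl : 1 ≤ l) (hC5 : 0 < C5)
    (hQv0 : 0 ≤ Qv) (hQv : Qv ≤ C5 * (s : ℝ) ^ (4 * (l + d)))
    (hNs : (N : ℝ) < C5 * ((s : ℝ) + 1) ^ (4 * (l + d))) (hε0 : 0 < ε) (hε2 : ε ≤ 1 / 2)
    (hρ0 : 0 ≤ ρ0) (hs1 : 1 ≤ s)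
    (hCρ : Cρ = 5 + 4 * Real.sqrt C5 * (2 : ℝ) ^ (2 * (l + d)) + 2 * |Real.log (C5 + 1)| +
      8 * (l + d) + ρ0) :
    1 + (4 * (N : ℝ) ^ ε + 2 * Real.log (Qv + 1) + ρ0) ≤ Cρ * (s : ℝ) ^ (2 * (l + d)) := by
  have hsR : (1 : ℝ) ≤ s := by exact_mod_cast hs1
  have hs0 : (0 : ℝ) ≤ s := by positivity
  obtain ⟨P, hP⟩ : ∃ P : ℝ, P = (s : ℝ) ^ (2 * (l + d)) := ⟨_, rfl⟩
  have hP1 : 1 ≤ P := by rw [hP]; exact one_le_pow₀ hsR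
  have hsP : (s : ℝ) ≤ P := by rw [hP]; exact le_self_pow₀ hsR (by omega)
  -- `N^ε ≤ 1 + √C5 · 2^{2(ℓ+d)} · P`
  obtain ⟨Y, hY⟩ : ∃ Y : ℝ, Y = C5 * (2 * (s : ℝ)) ^ (4 * (l + d)) := ⟨_, rfl⟩
  have hY0 : 0 < Y := by rw [hY]; positivity
  have hNY : (N : ℝ) ≤ Y := by
    rw [hY]
    exact hNs.le.trans
      (mul_le_mul_of_nonneg_left (pow_le_pow_left₀ (by positivity) (by linarith) _) hC5.le)
  have hsqrtY : Real.sqrt Y = Real.sqrt C5 * (2 : ℝ) ^ (2 * (l + d)) * P := by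
    rw [hY, Real.sqrt_mul hC5.le, show 4 * (l + d) = 2 * (l + d) * 2 by ring, pow_mul,
      Real.sqrt_sq (by positivity), mul_pow, hP]
    ring
  have hsq0 : 0 ≤ Real.sqrt C5 * (2 : ℝ) ^ (2 * (l + d)) * P := by
    rw [hP]; positivity
  have hNε : (N : ℝ) ^ ε ≤ 1 + Real.sqrt C5 * (2 : ℝ) ^ (2 * (l + d)) * P := by
    have h1 : (N : ℝ) ^ ε ≤ Y ^ ε := Real.rpow_le_rpow (Nat.cast_nonneg _) hNY hε0.le
    rcases le_or_gt Y 1 with hY1 | hY1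
    · have : Y ^ ε ≤ 1 := Real.rpow_le_one hY0.le hY1 hε0.le
      linarith
    · have h2 : Y ^ ε ≤ Y ^ ((1 : ℝ) / 2) := Real.rpow_le_rpow_of_exponent_le hY1.le hε2
      rw [← Real.sqrt_eq_rpow, hsqrtY] at h2
      linarith
  -- `log (Q_v + 1) ≤ |log (C5+1)| + 4(ℓ+d) s`
  have hlogQ : Real.log (Qv + 1) ≤ |Real.log (C5 + 1)| + 4 * (l + d) * s := by
    have hsq : (1 : ℝ) ≤ (s : ℝ) ^ (4 * (l + d)) := one_le_pow₀ hsR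
    have h1 : Qv + 1 ≤ (C5 + 1) * (s : ℝ) ^ (4 * (l + d)) := by nlinarith
    calc Real.log (Qv + 1) ≤ Real.log ((C5 + 1) * (s : ℝ) ^ (4 * (l + d))) :=
          Real.log_le_log (by linarith) h1
      _ = Real.log (C5 + 1) + (4 * (l + d) : ℕ) * Real.log s := by
          rw [Real.log_mul (by positivity) (by positivity), Real.log_pow]
      _ ≤ |Real.log (C5 + 1)| + 4 * (l + d) * s := by
          push_cast
          have := le_abs_self (Real.log (C5 + 1))
          have := mul_le_mul_of_nonneg_left (log_natCast_le s)
            (show (0 : ℝ) ≤ 4 * (l + d) by positivity)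
          linarith
  -- assemble
  rw [hCρ, ← hP]
  have hl0 : (0 : ℝ) ≤ l := Nat.cast_nonneg _
  have hd0 : (0 : ℝ) ≤ d := Nat.cast_nonneg _
  have e1 : (4 : ℝ) * (l + d) * s ≤ 4 * (l + d) * P := mul_le_mul_of_nonneg_left hsP (by positivity)
  have e3 : |Real.log (C5 + 1)| ≤ |Real.log (C5 + 1)| * P := le_mul_of_one_le_right (abs_nonneg _) hP1
  have e4 : ρ0 ≤ ρ0 * P := le_mul_of_one_le_right hρ0 hP1
  linarith

/-- **The family `(Q_r)_r` transported to `Fin (dℓ)` variables**: degrees, lengths, values at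
`θ` and the zero-free polydisc. [cite: NesterenkoPhilippon2001, Ch. 14 §3.3 Steps 3–4] -/
theorem exists_family_of_Qpoly (x : Fin d → ℂ) (y : Fin l → ℂ) (p : (Fin k × Fin d → Fin L) → ℤ)
    (hp1 : ∀ μ, |p μ| ≤ 1) {δ U ρ : ℝ} (hδ0 : 0 ≤ δ)
    (hdeg : ((d * l * (k * ((L - 1) * (R - 1))) : ℕ) : ℝ) ≤ δ)
    (hlen : Real.log (Fintype.card (Fin k × Fin d → Fin L)) ≤ δ)
    (hsmall : ∀ r : Fin k × Fin l → Fin R, ‖aeval (thetaGrid x y) (Qpoly p r)‖ ≤ Real.exp (-U))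
    (hzf : ∀ μ : Fin d → Fin l → ℂ, (∀ i j, ‖cexp (x i * y j) - μ i j‖ ≤ Real.exp (-ρ)) →
      ∃ r : Fin k × Fin l → Fin R, aeval (fun q : Fin d × Fin l => μ q.1 q.2) (Qpoly p r) ≠ 0) :
    ∃ (M : ℕ) (Q : Fin M → MvPolynomial (Fin (d * l)) ℤ),
      (∀ j, ((Q j).totalDegree : ℝ) ≤ δ) ∧ (∀ j, Real.log (Chudnovsky.l1 (Q j)) ≤ δ) ∧
      (∀ j, ‖aeval (thetaGrid x y ∘ finProdFinEquiv.symm) (Q j)‖ ≤ Real.exp (-U)) ∧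
      (∀ z : Fin (d * l) → ℂ,
        (∀ i, ‖z i - (thetaGrid x y ∘ finProdFinEquiv.symm) i‖ < Real.exp (-ρ)) →
        ∃ j, aeval z (Q j) ≠ 0) := by
  classical
  set e := Fintype.equivFin (Fin k × Fin l → Fin R) with he
  have hcomp : ((thetaGrid x y ∘ finProdFinEquiv.symm) ∘ (finProdFinEquiv : Fin d × Fin l ≃ Fin (d * l))) =
      thetaGrid x y := by
    ext q; simp
  refine ⟨_, fun j => rename finProdFinEquiv (Qpoly p (e.symm j)), fun j => ?_, fun j => ?_,
    fun j => ?_, fun z hz => ?_⟩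
  · calc ((rename finProdFinEquiv (Qpoly p (e.symm j))).totalDegree : ℝ)
        ≤ ((d * l * (k * ((L - 1) * (R - 1))) : ℕ) : ℝ) := by
          exact_mod_cast (totalDegree_rename_le _ _).trans (totalDegree_Qpoly_le p _)
      _ ≤ δ := hdeg
  · rw [PhilipponMain.l1_rename_of_injective finProdFinEquiv.injective]
    have h0 : 0 ≤ Chudnovsky.l1 (Qpoly p (e.symm j)) := Chudnovsky.wnorm_nonneg _ _
    have h1 : Chudnovsky.l1 (Qpoly p (e.symm j)) ≤ Fintype.card (Fin k × Fin d → Fin L) :=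
      (l1_Qpoly_le p _).trans (by
        calc ∑ lam, (|p lam| : ℝ) ≤ ∑ _lam : (Fin k × Fin d → Fin L), (1 : ℝ) :=
              Finset.sum_le_sum fun lam _ => by exact_mod_cast hp1 lam
          _ = Fintype.card (Fin k × Fin d → Fin L) := by simp)
    rcases h0.eq_or_lt with h | h
    · rw [← h, Real.log_zero]; exact hδ0
    · exact (Real.log_le_log h h1).trans hlen
  · rw [aeval_rename, hcomp]; exact hsmall _
  · obtain ⟨r, hr⟩ := hzf (fun i j => z (finProdFinEquiv (i, j))) fun i j => by
      have := hz (finProdFinEquiv (i, j))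
      rw [Function.comp_apply, Equiv.symm_apply_apply, norm_sub_rev] at this
      exact this.le
    refine ⟨e r, ?_⟩
    show aeval z (rename finProdFinEquiv (Qpoly p (e.symm (e r)))) ≠ 0
    rw [Equiv.symm_apply_apply, aeval_rename]
    exact hr

end Helpers

/-! ### §5. One clean level yields the data of the one-level criterion -/

section Main

variable {d l : ℕ}

/-- **The transcendence machine at ONE clean level** (Waldschmidt's Steps 1–3 of LNM 1752 Ch. 14
§3.3 with `kk` redundant variables and integer coefficients `p_λ ∈ {0, ±1}`, run at a level `N`
where Brownawell's (4.1) holds): for `d, ℓ ≥ 2`, `dℓ > d + ℓ`, `ℚ`-linearly independent `x, y`, a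
constant `c` of Diaz's zero lemma, any `K ≥ 1` and `0 < ε ≤ 1/2`, there is `N₀` such that every clean
level `N ≥ N₀` produces reals `δ, σ ≥ 1`, `R ≥ 0`, `U` with `K(σ+δ)δ^{κ₀−1} ≤ U`, `Kδ^{κ₀−1}(1+R) ≤ U`
(`κ₀ = [(dℓ−1)/(d+ℓ)]`) and finitely many integer polynomials in the `dℓ` variables, of degrees `≤ δ`,
`log L ≤ σ`, values `≤ e^{−U}` at `θ = (e^{x_iy_j})`, without common zero in the polydisc `e^{−R}`
around `θ`. [cite: NesterenkoPhilippon2001, Ch. 14 §3.3 Steps 1–3 (PDF pp. 256–257)]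
[cite: Brownawell1987, §V i)–iii) and Thm 6.2 (PDF pp. 126–127)] -/
theorem exists_family_at_clean_level (hd : 2 ≤ d) (hl : 2 ≤ l) (hdl : d + l < d * l)
    {x : Fin d → ℂ} {y : Fin l → ℂ} (hx : LinearIndependent ℚ x) (hy : LinearIndependent ℚ y)
    {c : ℝ} (hc : 0 < c) (hZ : DiazThm1.ZeroLemmaAt d (by omega) c) {K : ℝ} (hK : 1 ≤ K)
    {ε : ℝ} (hε : 0 < ε) (hε2 : ε ≤ 1 / 2) :
    ∃ N₀ : ℕ, ∀ N : ℕ, N₀ ≤ N → BrownawellLevel ε x y N →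
      ∃ (δ σ Rr U : ℝ) (M : ℕ) (Q : Fin M → MvPolynomial (Fin (d * l)) ℤ),
        1 ≤ δ ∧ 1 ≤ σ ∧ 0 ≤ Rr ∧
        K * (σ + δ) * δ ^ ((d * l - 1) / (d + l) - 1) ≤ U ∧
        K * δ ^ ((d * l - 1) / (d + l) - 1) * (1 + Rr) ≤ U ∧
        (∀ j, ((Q j).totalDegree : ℝ) ≤ δ) ∧
        (∀ j, Real.log (Chudnovsky.l1 (Q j)) ≤ σ) ∧
        (∀ j, ‖aeval (thetaGrid x y ∘ finProdFinEquiv.symm) (Q j)‖ ≤ Real.exp (-U)) ∧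
        (∀ z : Fin (d * l) → ℂ, (∀ i, ‖z i - (thetaGrid x y ∘ finProdFinEquiv.symm) i‖ < Real.exp (-Rr)) →
          ∃ j, aeval z (Q j) ≠ 0) := by
  classical
  /- Step 0: the constants. -/
  obtain ⟨hκdl, hκ1⟩ := kappa_facts hdl
  obtain ⟨κ, hκ⟩ : ∃ κ : ℕ, κ = (d * l - 1) / (d + l) := ⟨_, rfl⟩
  rw [← hκ] at hκdl hκ1
  have hmargin := count_margin hdl
  rw [← hκ] at hmargin
  obtain ⟨a, ha⟩ : ∃ a : ℕ, a = 2 * (d + l) * κ + 1 := ⟨_, rfl⟩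
  rw [← ha] at hmargin
  obtain ⟨kk, hkk⟩ : ∃ kk : ℕ, kk = a + 3 := ⟨_, rfl⟩
  rw [← hkk] at hmargin
  have hd1 : 1 ≤ d := by omega
  have hkk1 : 1 ≤ kk := by omega
  obtain ⟨G, hG⟩ : ∃ G : ℕ, G = (d + 1).factorial * (kk * d) ^ d + 1 := ⟨_, rfl⟩
  obtain ⟨CR, hCR⟩ : ∃ CR : ℕ, CR = 2 * (d + 1) * G := ⟨_, rfl⟩
  have hG1 : 1 ≤ G := by rw [hG]; exact Nat.le_add_left 1 _
  have hCR2 : 2 ≤ CR := by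
    rw [hCR]
    calc 2 = 2 * 1 * 1 := rfl
      _ ≤ 2 * (d + 1) * G := Nat.mul_le_mul (Nat.mul_le_mul_left 2 (Nat.succ_pos d)) hG1
  obtain ⟨X1, hX1⟩ : ∃ X1 : ℝ, X1 = ∑ i, ‖x i‖ := ⟨_, rfl⟩
  obtain ⟨Y1, hY1⟩ : ∃ Y1 : ℝ, Y1 = ∑ j, ‖y j‖ := ⟨_, rfl⟩
  have hX10 : 0 ≤ X1 := by rw [hX1]; exact Finset.sum_nonneg fun i _ => norm_nonneg _
  have hY10 : 0 ≤ Y1 := by rw [hY1]; exact Finset.sum_nonneg fun j _ => norm_nonneg _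
  obtain ⟨Cδ, hCδ⟩ : ∃ Cδ : ℝ, Cδ = d * l * kk * CR := ⟨_, rfl⟩
  obtain ⟨CW, hCW⟩ : ∃ CW : ℝ, CW = kk * CR * (X1 + 1) * (Y1 + 1) := ⟨_, rfl⟩
  obtain ⟨T1, hT1⟩ : ∃ T1 : ℕ, T1 = ⌈8 * CW⌉₊ := ⟨_, rfl⟩
  obtain ⟨Δ, hΔ⟩ : ∃ Δ : ℝ, Δ = DiazThm1.Delta0 x y := ⟨_, rfl⟩
  have hΔ0 : 0 < Δ := by rw [hΔ]; exact DiazThm1.Delta0_pos x y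
  obtain ⟨C5, hC5⟩ : ∃ C5 : ℝ, C5 = c * Δ * ((kk : ℝ) * d) ^ 2 * (CR : ℝ) ^ 2 := ⟨_, rfl⟩
  have hC50 : 0 < C5 := by rw [hC5]; positivity
  obtain ⟨ρ0, hρ0⟩ : ∃ ρ0 : ℝ, ρ0 = 4 * ((∑ i, ∑ j, ‖cexp (-(x i * y j))‖) + l + 1) + 2 := ⟨_, rfl⟩
  have hρ0pos : 2 ≤ ρ0 := by
    rw [hρ0]
    have : 0 ≤ ∑ i, ∑ j, ‖cexp (-(x i * y j))‖ :=
      Finset.sum_nonneg fun i _ => Finset.sum_nonneg fun j _ => norm_nonneg _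
    have : (0 : ℝ) ≤ l := Nat.cast_nonneg _
    linarith
  -- more constants: `CT` (so that `T ≤ CT sᵃ`), `Cx` (so that `2 + log X ≤ Cx s^{a+1}`), `Cρ`
  obtain ⟨CT, hCT⟩ : ∃ CT : ℝ, CT = 2 + T1 + 2 * l * kk * d := ⟨_, rfl⟩
  have hCT1 : 1 ≤ CT := by
    rw [hCT]
    have : (0 : ℝ) ≤ T1 := Nat.cast_nonneg _
    have : (0 : ℝ) ≤ 2 * l * kk * d := by positivity
    linarith
  obtain ⟨Cx, hCx⟩ : ∃ Cx : ℝ, Cx = 6 + 2 * l * kk * d + kk * CT * (2 * l + X1 + 1) + kk * CR * (Y1 + 1) :=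
    ⟨_, rfl⟩
  have hCx0 : 0 ≤ Cx := by rw [hCx]; positivity
  obtain ⟨Cρ, hCρ⟩ : ∃ Cρ : ℝ, Cρ = 5 + 4 * Real.sqrt C5 * (2 : ℝ) ^ (2 * (l + d)) +
      2 * |Real.log (C5 + 1)| + 8 * (l + d) + ρ0 := ⟨_, rfl⟩
  have hCρ0 : 0 ≤ Cρ := by rw [hCρ]; positivity
  have hK0 : 0 < K := by linarith
  have hCδ1 : 1 ≤ Cδ := by
    rw [hCδ]
    have h1 : (1 : ℝ) ≤ d := by exact_mod_cast hd1
    have h2 : (1 : ℝ) ≤ l := by exact_mod_cast (show 1 ≤ l by omega)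
    have h3 : (1 : ℝ) ≤ kk := by exact_mod_cast hkk1
    have h4 : (1 : ℝ) ≤ CR := by exact_mod_cast (show 1 ≤ CR by omega)
    have := one_le_mul_of_one_le_of_one_le (one_le_mul_of_one_le_of_one_le (one_le_mul_of_one_le_of_one_le h1 h2) h3) h4
    simpa [mul_assoc] using this
  have hCδ0 : 0 < Cδ := by linarith
  /- the thresholds on `s` and the first level `N₀` -/
  obtain ⟨s₀, hs₀⟩ : ∃ s₀ : ℕ, s₀ = max (max (max 2 ((d + 1) * kk * d + 1)) (max ⌈2 * K * Cδ ^ κ⌉₊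
      ⌈K * Cδ ^ (κ - 1) * Cρ⌉₊)) ⌈2 * CT ^ kk * Cx / Real.log 2⌉₊ := ⟨_, rfl⟩
  have hs₀2 : 2 ≤ s₀ := hs₀ ▸ le_max_of_le_left (le_max_of_le_left (le_max_left _ _))
  have hs₀Z : (d + 1) * kk * d + 1 ≤ s₀ :=
    hs₀ ▸ le_max_of_le_left (le_max_of_le_left (le_max_right _ _))
  have hs₀A1n : ⌈2 * K * Cδ ^ κ⌉₊ ≤ s₀ :=
    hs₀ ▸ le_max_of_le_left (le_max_of_le_right (le_max_left _ _))
  have hs₀A2n : ⌈K * Cδ ^ (κ - 1) * Cρ⌉₊ ≤ s₀ :=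
    hs₀ ▸ le_max_of_le_left (le_max_of_le_right (le_max_right _ _))
  have hs₀Bn : ⌈2 * CT ^ kk * Cx / Real.log 2⌉₊ ≤ s₀ := hs₀ ▸ le_max_right _ _
  have hs₀A1 : 2 * K * Cδ ^ κ ≤ s₀ := (Nat.le_ceil _).trans (by exact_mod_cast hs₀A1n)
  have hs₀A2 : K * Cδ ^ (κ - 1) * Cρ ≤ s₀ := (Nat.le_ceil _).trans (by exact_mod_cast hs₀A2n)
  have hs₀B : 2 * CT ^ kk * Cx / Real.log 2 ≤ s₀ := (Nat.le_ceil _).trans (by exact_mod_cast hs₀Bn)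
  obtain ⟨q, hq⟩ : ∃ q : ℕ, q = 4 * (l + d) := ⟨_, rfl⟩
  have hq1 : 1 ≤ q := by rw [hq]; omega
  refine ⟨⌈C5 * (s₀ : ℝ) ^ q⌉₊, fun N hN hclean => ?_⟩
  /- Step 1: the base parameter `s` of the level. -/
  obtain ⟨s, hsdef⟩ : ∃ s : ℕ, s = ⌊((N : ℝ) / C5) ^ ((1 : ℝ) / q)⌋₊ := ⟨_, rfl⟩
  have hbase := base_param_facts hC50 hq1 N s₀ ((Nat.le_ceil _).trans (by exact_mod_cast hN))
  rw [← hsdef] at hbase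
  obtain ⟨hs₀s, hsN, hNs⟩ := hbase
  have hs2 : 2 ≤ s := hs₀2.trans hs₀s
  have hs1 : 1 ≤ s := by omega
  have hsR1 : (1 : ℝ) ≤ s := by exact_mod_cast hs1
  have hsR0 : (0 : ℝ) < s := lt_of_lt_of_le one_pos hsR1
  have hs₀sR : (s₀ : ℝ) ≤ s := by exact_mod_cast hs₀s
  subst hq
  rw [← hκ]
  /- Step 2: the parameters of the level. -/
  obtain ⟨L, hL⟩ : ∃ L : ℕ, L = s ^ (2 * l) := ⟨_, rfl⟩
  obtain ⟨Rn, hRn⟩ : ∃ Rn : ℕ, Rn = CR * s ^ (2 * d) := ⟨_, rfl⟩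
  obtain ⟨T, hT⟩ : ∃ T : ℕ, T = s ^ a + T1 * s ^ (2 * (l + d)) + 2 * l * kk * d * s + 1 := ⟨_, rfl⟩
  obtain ⟨Bb, hBb⟩ : ∃ Bb : ℝ, Bb = (s : ℝ) ^ (2 * l) * (X1 + 1) := ⟨_, rfl⟩
  obtain ⟨Zb, hZb⟩ : ∃ Zb : ℝ, Zb = (CR : ℝ) * (s : ℝ) ^ (2 * d) * (Y1 + 1) := ⟨_, rfl⟩
  obtain ⟨η, hη⟩ : ∃ η : ℝ, η = Real.exp (-((s : ℝ) ^ a +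
      kk * ((CR : ℝ) * (s : ℝ) ^ (2 * d) * (Y1 + 1)))) / 4 := ⟨_, rfl⟩
  obtain ⟨δ, hδ⟩ : ∃ δ : ℝ, δ = Cδ * (s : ℝ) ^ (2 * (l + d)) := ⟨_, rfl⟩
  have hL1 : 1 ≤ L := by rw [hL]; exact Nat.one_le_pow _ _ hs1
  have hT1' : 1 ≤ T := by rw [hT]; exact Nat.le_add_left 1 _
  have hpow1 : (1 : ℝ) ≤ (s : ℝ) ^ (2 * (l + d)) := one_le_pow₀ hsR1
  have hpow0 : (0 : ℝ) ≤ (s : ℝ) ^ (2 * (l + d)) := zero_le_one.trans hpow1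
  have hBb1 : 1 ≤ Bb := by
    rw [hBb]
    calc (1 : ℝ) = 1 * 1 := by ring
      _ ≤ (s : ℝ) ^ (2 * l) * (X1 + 1) :=
          mul_le_mul (one_le_pow₀ hsR1) (by linarith only [hX10]) zero_le_one (by positivity)
  have hη0 : 0 < η := by rw [hη]; positivity
  have hη1 : η ≤ 1 := by
    rw [hη]
    have : Real.exp (-((s : ℝ) ^ a + kk * ((CR : ℝ) * (s : ℝ) ^ (2 * d) * (Y1 + 1)))) ≤ 1 :=
      Real.exp_le_one_iff.mpr (neg_nonpos.mpr (by positivity))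
    linarith only [this]
  have hδ1 : 1 ≤ δ := by rw [hδ]; exact one_le_mul_of_one_le_of_one_le hCδ1 hpow1
  have hδ0 : 0 ≤ δ := zero_le_one.trans hδ1
  have ha2 : 2 * (l + d) ≤ a := by
    have h1 : 2 * (d + l) * 1 ≤ 2 * (d + l) * κ := Nat.mul_le_mul_left _ hκ1
    rw [ha]
    calc 2 * (l + d) = 2 * (d + l) * 1 := by ring
      _ ≤ 2 * (d + l) * κ := h1
      _ ≤ 2 * (d + l) * κ + 1 := Nat.le_succ _
  have ha1 : 1 ≤ a := by rw [ha]; exact Nat.le_add_left 1 _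
  have hlog2 : 0 < Real.log 2 := Real.log_pos (by norm_num)
  /- Step 3: Dirichlet's box principle. -/
  have hb : ∀ (μ : Fin kk × Fin d → Fin L) (h : Fin kk), ‖bvec x μ h‖ ≤ Bb := fun μ h =>
    (norm_bvec_le x μ h).trans (by
      rw [hBb, ← hX1, hL]; push_cast
      exact mul_le_mul_of_nonneg_left (by linarith only) (pow_nonneg hsR0.le (2 * l)))
  have hsB : 2 * CT ^ kk * Cx ≤ s * Real.log 2 := by
    have h1 : 2 * CT ^ kk * Cx ≤ s₀ * Real.log 2 := (div_le_iff₀ hlog2).mp hs₀B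
    exact h1.trans (mul_le_mul_of_nonneg_right hs₀sR hlog2.le)
  have hcount := count_bound_at hX10 hY10 hCT hCx hL hT hBb hη ha2 ha1 hmargin hs1 hsB
  obtain ⟨p, hp0, hp1, hpC⟩ := exists_p_small x hL1 hBb1 hb hη0 hη1 hcount
  /- Step 4: smallness of all `Q_r(θ)`. -/
  have hz : ∀ (r : Fin kk × Fin l → Fin Rn) (h : Fin kk), ‖zvec y r h‖ ≤ Zb := fun r h =>
    (norm_zvec_le y r h).trans (by
      rw [hZb, ← hY1, hRn]; push_cast
      exact mul_le_mul_of_nonneg_left (by linarith only) (by positivity))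
  obtain ⟨hTexp, hTU⟩ := T_lower_facts hX10 hY10 hCW hT1 hL hT hBb hZb hs1
  have hC : ∀ κ' : Fin kk → ℕ, (∀ h, κ' h < T) →
      ‖∑ μ, (p μ : ℂ) * ∏ h, bvec x μ h ^ κ' h‖ ≤ Real.exp (-((s : ℝ) ^ a + kk * Zb)) / 2 :=
    fun κ' hκ' => (hpC κ' hκ').trans (le_of_eq (by rw [hη, hZb]; ring))
  have hsmall : ∀ r : Fin kk × Fin l → Fin Rn,
      ‖aeval (thetaGrid x y) (Qpoly p r)‖ ≤ Real.exp (-(s : ℝ) ^ a) :=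
    norm_aeval_Qpoly_le_of_dirichlet x y p hp1 hL1 hBb1 hb hz hT1' hTexp hTU hC
  /- Step 5: the zero-free polydisc around `θ`. -/
  have hC5' : C5 = c * DiazThm1.Delta0 x y * ((kk : ℝ) * d) ^ 2 * (CR : ℝ) ^ 2 := by rw [hC5, hΔ]
  obtain ⟨Qv, hQv⟩ : ∃ Qv : ℝ, Qv = c * DiazThm1.Delta0 x y * ((kk : ℝ) * d * (s : ℝ) ^ (2 * l)) ^ 2 *
      ((((Rn - 1 : ℕ) : ℝ)) / (d + 1)) ^ 2 := ⟨_, rfl⟩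
  obtain ⟨ρ, hρ⟩ : ∃ ρ : ℝ, ρ = 4 * (N : ℝ) ^ ε + 2 * Real.log (Qv + 1) + ρ0 := ⟨_, rfl⟩
  have hzf : ∀ μ : Fin d → Fin l → ℂ, (∀ i j, ‖cexp (x i * y j) - μ i j‖ ≤ Real.exp (-ρ)) →
      ∃ r : Fin kk × Fin l → Fin Rn, aeval (fun q : Fin d × Fin l => μ q.1 q.2) (Qpoly p r) ≠ 0 :=
    fun μ hμ => exists_r_ne_zero_at hd hl hkk1 hx hy hc hZ hG hCR hL hRn hs1 hC5' hsN hclean hp0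
      hQv hρ0 hρ hμ
  /- Step 6: the family `(Q_r)` in `dℓ` variables. -/
  have hdeg : ((d * l * (kk * ((L - 1) * (Rn - 1))) : ℕ) : ℝ) ≤ δ := by
    have h1 : d * l * (kk * ((L - 1) * (Rn - 1))) ≤ d * l * (kk * (L * Rn)) :=
      Nat.mul_le_mul_left _ (Nat.mul_le_mul_left _ (Nat.mul_le_mul (Nat.sub_le _ _) (Nat.sub_le _ _)))
    calc ((d * l * (kk * ((L - 1) * (Rn - 1))) : ℕ) : ℝ) ≤ ((d * l * (kk * (L * Rn)) : ℕ) : ℝ) := by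
          exact_mod_cast h1
      _ = δ := by
          rw [hδ, hCδ, hL, hRn]; push_cast
          rw [show 2 * (l + d) = 2 * l + 2 * d by ring, pow_add]; ring
  have hCR2R : (2 : ℝ) ≤ CR := by exact_mod_cast hCR2
  have hlen : Real.log (Fintype.card (Fin kk × Fin d → Fin L)) ≤ δ := by
    have hcard : (Fintype.card (Fin kk × Fin d → Fin L) : ℝ) = (s : ℝ) ^ (2 * l * (kk * d)) := by
      rw [Fintype.card_fun, Fintype.card_prod, Fintype.card_fin, Fintype.card_fin, Fintype.card_fin,
        hL]
      push_cast; rw [← pow_mul]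
    rw [hcard, Real.log_pow, hδ, hCδ]; push_cast
    have h1 := mul_le_mul_of_nonneg_left (log_natCast_le s)
      (show (0 : ℝ) ≤ 2 * l * (kk * d) by positivity)
    have h2 : (s : ℝ) ≤ (s : ℝ) ^ (2 * (l + d)) := le_self_pow₀ hsR1 (by omega)
    have h3 : 2 * (s : ℝ) ≤ CR * (s : ℝ) ^ (2 * (l + d)) :=
      mul_le_mul hCR2R h2 hsR0.le (by positivity)
    have h4 := mul_le_mul_of_nonneg_left h3 (show (0 : ℝ) ≤ d * l * kk by positivity)
    linarith only [h1, h4]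
  obtain ⟨M, Q, hQdeg, hQlen, hQsmall, hQzf⟩ :=
    exists_family_of_Qpoly x y p hp1 hδ0 hdeg hlen hsmall hzf
  /- Step 7: the inequalities of the criterion. -/
  have hQv0 : 0 ≤ Qv := by rw [hQv]; have := DiazThm1.Delta0_pos x y; positivity
  have hNε : 0 ≤ (N : ℝ) ^ ε := Real.rpow_nonneg (Nat.cast_nonneg _) _
  have hlogQ : 0 ≤ Real.log (Qv + 1) := Real.log_nonneg (by linarith only [hQv0])
  have hρpos : 0 ≤ ρ := by rw [hρ]; linarith only [hNε, hlogQ, hρ0pos]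
  -- `Q_v ≤ C₅ s^{4(ℓ+d)}`
  have hQvle : Qv ≤ C5 * (s : ℝ) ^ (4 * (l + d)) := by
    have hρR : (((Rn - 1 : ℕ) : ℝ)) / (d + 1) ≤ (CR : ℝ) * (s : ℝ) ^ (2 * d) := by
      rw [div_le_iff₀ (by positivity)]
      have h1 : ((Rn - 1 : ℕ) : ℝ) ≤ Rn := by exact_mod_cast Nat.sub_le Rn 1
      have h2 : (Rn : ℝ) = CR * (s : ℝ) ^ (2 * d) := by rw [hRn]; push_cast; ring
      rw [h2] at h1
      exact h1.trans (le_mul_of_one_le_right (by positivity)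
        (le_add_of_nonneg_left (Nat.cast_nonneg d)))
    have hρR0 : 0 ≤ (((Rn - 1 : ℕ) : ℝ)) / (d + 1) := by positivity
    rw [hQv, hC5']
    have hΔ0' := DiazThm1.Delta0_pos x y
    calc c * DiazThm1.Delta0 x y * ((kk : ℝ) * d * (s : ℝ) ^ (2 * l)) ^ 2 *
          ((((Rn - 1 : ℕ) : ℝ)) / (d + 1)) ^ 2
        ≤ c * DiazThm1.Delta0 x y * ((kk : ℝ) * d * (s : ℝ) ^ (2 * l)) ^ 2 *
          ((CR : ℝ) * (s : ℝ) ^ (2 * d)) ^ 2 :=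
          mul_le_mul_of_nonneg_left (pow_le_pow_left₀ hρR0 hρR 2) (by positivity)
      _ = c * DiazThm1.Delta0 x y * ((kk : ℝ) * d) ^ 2 * (CR : ℝ) ^ 2 * (s : ℝ) ^ (4 * (l + d)) := by
          rw [show 4 * (l + d) = 2 * l * 2 + 2 * d * 2 by ring, pow_add, pow_mul, pow_mul]; ring
  have hρ1 : 1 + ρ ≤ Cρ * (s : ℝ) ^ (2 * (l + d)) := by
    rw [hρ]
    exact one_add_rho_le (by omega) hC50 hQv0 hQvle hNs hε hε2 (by linarith only [hρ0pos]) hs1 hCρ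
  -- the exponent identities
  have hsa_eq : (s : ℝ) ^ a = (s : ℝ) * (s : ℝ) ^ (2 * (l + d) * κ) := by
    rw [ha, show 2 * (d + l) * κ + 1 = 2 * (l + d) * κ + 1 by ring, pow_succ]; ring
  have hexpκ : 2 * (l + d) * (κ - 1) + 2 * (l + d) = 2 * (l + d) * κ := by
    conv_rhs => rw [← Nat.sub_add_cancel hκ1]
    ring
  have hpowκ0 : (0 : ℝ) ≤ (s : ℝ) ^ (2 * (l + d) * κ) := by positivity
  have hA1 : K * (δ + δ) * δ ^ (κ - 1) ≤ (s : ℝ) ^ a := by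
    have e1 : K * (δ + δ) * δ ^ (κ - 1) = 2 * K * δ ^ κ := by
      have : δ ^ κ = δ ^ (κ - 1) * δ := (pow_sub_one_mul (by omega) δ).symm
      rw [this]; ring
    have e2 : δ ^ κ = Cδ ^ κ * (s : ℝ) ^ (2 * (l + d) * κ) := by rw [hδ, mul_pow, ← pow_mul]
    rw [e1, mul_assoc, e2, ← mul_assoc, ← mul_assoc, hsa_eq]
    have h1 : 2 * K * Cδ ^ κ ≤ s := hs₀A1.trans hs₀sR
    exact mul_le_mul_of_nonneg_right h1 hpowκ0
  have hA2 : K * δ ^ (κ - 1) * (1 + ρ) ≤ (s : ℝ) ^ a := by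
    have e2 : δ ^ (κ - 1) = Cδ ^ (κ - 1) * (s : ℝ) ^ (2 * (l + d) * (κ - 1)) := by
      rw [hδ, mul_pow, ← pow_mul]
    have h0 : 0 ≤ K * δ ^ (κ - 1) := by positivity
    calc K * δ ^ (κ - 1) * (1 + ρ) ≤ K * δ ^ (κ - 1) * (Cρ * (s : ℝ) ^ (2 * (l + d))) :=
          mul_le_mul_of_nonneg_left hρ1 h0
      _ = (K * Cδ ^ (κ - 1) * Cρ) * (s : ℝ) ^ (2 * (l + d) * κ) := by
          rw [e2, ← hexpκ, pow_add]; ring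
      _ ≤ (s : ℝ) * (s : ℝ) ^ (2 * (l + d) * κ) :=
          mul_le_mul_of_nonneg_right (hs₀A2.trans hs₀sR) hpowκ0
      _ = (s : ℝ) ^ a := hsa_eq.symm
  exact ⟨δ, δ, ρ, (s : ℝ) ^ a, M, Q, hδ1, hδ1, hρpos, hA1, hA2, hQdeg, hQlen, hQsmall, hQzf⟩

end Main

end Brownawell

/-! ### §6. Brownawell's Theorem 6.2 (exponential case) from LNM 1752 Ch. 3 Prop. 4.11 -/

/-- **Linear independence from the clean levels**: if for arbitrarily large `N` every non-zero
integer form `∑ s_i u_i` with `|s_i| ≤ N` is `≥ e^{−N^ε}` in absolute value, then the `u_i` are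
`ℚ`-linearly independent (Brownawell: "(4.1) holds for infinitely many N" forces the standing
hypothesis of §IV that the `u_i` and the `v_j` are linearly independent).
[cite: Brownawell1987, §IV.A (PDF p. 124)] -/
theorem linearIndependent_of_levels {m : ℕ} {u : Fin m → ℂ} {ε : ℝ}
    (h : ∀ N₀ : ℕ, ∃ N : ℕ, N₀ ≤ N ∧ ∀ s : Fin m → ℤ, s ≠ 0 → (∀ i, |s i| ≤ (N : ℤ)) →
      Real.exp (-((N : ℝ) ^ ε)) ≤ ‖∑ i, (s i : ℂ) * u i‖) :
    LinearIndependent ℚ u := by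
  rw [← LinearIndependent.iff_fractionRing ℤ ℚ, Fintype.linearIndependent_iff]
  intro g hg
  by_contra hne
  push Not at hne
  have hg0 : g ≠ 0 := by
    obtain ⟨i, hi⟩ := hne
    intro h0
    exact hi (by rw [h0]; rfl)
  obtain ⟨N, hN, hlev⟩ := h (Finset.univ.sup fun i => (g i).natAbs)
  have hbd : ∀ i, |g i| ≤ (N : ℤ) := fun i => by
    have h1 : (g i).natAbs ≤ N :=
      le_trans (Finset.le_sup (f := fun i => (g i).natAbs) (Finset.mem_univ i)) hN
    rw [← Int.natCast_natAbs]
    exact_mod_cast h1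
  have hsmall := hlev g hg0 hbd
  have hsum : ∑ i, (g i : ℂ) * u i = 0 := by simpa [zsmul_eq_mul] using hg
  rw [hsum, norm_zero] at hsmall
  exact absurd hsmall (not_le.mpr (Real.exp_pos _))

/-- **Brownawell's Theorem 6.2, exponential case (LNM 1290), from LNM 1752 Ch. 3 Prop. 4.11.**
If `0 < ε < 1/24` and Brownawell's hypothesis (4.1) holds at the level `N` for infinitely many `N`,
then `trdeg_ℚ ℚ(e^{u_iv_j}) ≥ ⌈mn/(m+n)⌉ − 1 = [(mn−1)/(m+n)]`. Proof: Waldschmidt's transcendence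
construction with redundant variables (LNM 1752 Ch. 14 §3.3) run at ONE clean level
(`Brownawell.exists_family_at_clean_level`: Dirichlet's box principle for the coefficients,
smallness at `θ`, and the zero-free polydisc from G. Diaz's zero lemma fed by (4.1)), closed by the
one-level criterion `Brownawell.oneLevelCriterionMax_of_prop_4_11` (Jabbouri's criterion, proved in
the tree from LNM 1752 Ch. 3 §4 modulo Prop. 4.11). The hypothesis `ε < 1/24` of the source is only
used as `ε ≤ 1/2`. [cite: Brownawell1987, Thm 6.2 (PDF p. 127), §IV.A (4.1) (PDF p. 124), §V (PDF pp. 126–127)]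
[cite: NesterenkoPhilippon2001, Ch. 14 §3.3 (PDF pp. 255–257); Ch. 3 Prop. 4.11] -/
theorem Brownawell1987_thm_6_2_exp_of_prop_4_11
    (h411 : Nesterenko.NesterenkoPhilippon2001_ch3_prop_4_11) : Brownawell1987_thm_6_2_exp := by
  intro ε hε hε24 m n u v hm hn hlevels
  obtain ⟨κ₀, hκ₀⟩ : ∃ κ₀ : ℕ, κ₀ = (m * n - 1) / (m + n) := ⟨_, rfl⟩
  rw [← hκ₀]
  rcases Nat.eq_zero_or_pos κ₀ with h0 | hpos
  · rw [h0]; simp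
  -- `m + n < mn`, hence `m, n ≥ 2`
  have hmn : m + n < m * n := by
    by_contra hc
    push Not at hc
    have : (m * n - 1) / (m + n) = 0 := Nat.div_eq_of_lt (by omega)
    omega
  have hm2 : 2 ≤ m := by
    by_contra h2
    have h1 : m = 1 := by omega
    subst h1; omega
  have hn2 : 2 ≤ n := by
    by_contra h2
    have h1 : n = 1 := by omega
    subst h1; omega
  -- the `u_i` and the `v_j` are `ℚ`-linearly independent
  have hu : LinearIndependent ℚ u := linearIndependent_of_levels (ε := ε) fun N₀ => by
    obtain ⟨N, hN, hl⟩ := hlevels N₀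
    exact ⟨N, hN, hl.1⟩
  have hv : LinearIndependent ℚ v := linearIndependent_of_levels (ε := ε) fun N₀ => by
    obtain ⟨N, hN, hl⟩ := hlevels N₀
    exact ⟨N, hN, hl.2⟩
  -- Diaz's zero lemma constant, the criterion constant, the clean level
  obtain ⟨c, hc, hZ⟩ := DiazThm1.exists_zeroLemmaAt Diaz1989_zeroLemma_holds m (by omega)
  have hkn : κ₀ - 1 < m * n := by
    have : κ₀ ≤ m * n := by rw [hκ₀]; exact (Nat.div_le_self _ _).trans (Nat.sub_le _ _)
    omega
  obtain ⟨K, hK1, hK⟩ := Brownawell.oneLevelCriterionMax_of_prop_4_11 h411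
    (Brownawell.thetaGrid u v ∘ finProdFinEquiv.symm) hkn
  obtain ⟨N₀, hN₀⟩ :=
    Brownawell.exists_family_at_clean_level hm2 hn2 hmn hu hv hc hZ hK1 hε (by linarith)
  obtain ⟨N, hN, hclean⟩ := hlevels N₀
  obtain ⟨δ, σ, Rr, U, M, Q, hδ, hσ, hRr, hA1, hA2, hdeg, hlen, hsmall, hzf⟩ := hN₀ N hN hclean
  rw [← hκ₀] at hA1 hA2
  have key := hK δ σ Rr U hδ hσ hRr hA1 hA2 M Q hdeg hlen hsmall hzf
  rw [Nat.sub_add_cancel hpos] at key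
  have hrange : Set.range (Brownawell.thetaGrid u v ∘ finProdFinEquiv.symm) =
      Set.range (fun p : Fin m × Fin n => cexp (u p.1 * v p.2)) :=
    finProdFinEquiv.symm.surjective.range_comp _
  rwa [hrange] at key

end Literature.NumberTheory.Transcendental

end
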